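import Literature.MathematicalPhysics.QuantumFieldTheory.Balaban1983to89.Node00.OpsYRecordV4
import Literature.MathematicalPhysics.QuantumFieldTheory.Balaban1983to89.Node00.OpsYHolderFar
import Literature.MathematicalPhysics.QuantumFieldTheory.Balaban1983to89.B9Cor35ComparisonsGpCAtLetters
import Literature.MathematicalPhysics.QuantumFieldTheory.Balaban1983to89.B9Ineq343to345T
import Literature.MathematicalPhysics.QuantumFieldTheory.Balaban1983to89.Node00.CarriersYU

/-!
# NODE 00 — `Node00.OpsYHolderT`: print's (3.40) **U-TRANSPORTED HÖLDER DATA NORM** `‖λ‖^{U}_ε` of the lifted data `λ = f ⊗ E` at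
# NODE 00's letters, typed AS the `holderT : Cfg → ℝ → Loc → ℝ` slot of the companion frames `B9Ineq343to345T.Thm31∕33∕34PrintedT`;
# its trivial-transport face (= the v4 field `geo9K.holder`), its DOMINATION of the v4 field at EVERY configuration, and the transfer
# «v4 frame ⇒ T-frame» at every KIdx-indexed carriers family

T. Bałaban, *Propagators for lattice gauge theories in a background field*, Commun. Math. Phys. **99** (1985) 389–434
[`Balaban1985BackgroundPropagators`, "B9"]; [4] = T. Bałaban, *Propagators and renormalization transformations for lattice gauge
theories. II*, Commun. Math. Phys. **96** (1984) 223–250 [`Balaban1984PropagatorsII`]; [I] = part I, Commun. Math. Phys. **95** (1984) 17–40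
[`Balaban1984PropagatorsI`].

statement-level skeleton of published theorems with citation tags; proofs where landed; nothing here is a claim about the
Yang–Mills mass gap

THE PRINTED LOCI (text layer `paper:balaban1985-cmp99-background-propagators`, journal page = PDF page + 388).  p. 397 l. 4–6: *«To formulate
the regularity and decay properties we have to introduce several norms. They are identical to the norms used in [3, 4], e.g., given by (1.108),
(1.109), but the derivatives there have to be replaced by the corresponding covariant derivatives determined by a configuration U.»*; (3.39) p. 397
and (3.40) p. 397 are printed for VECTOR functions — *«|A| = max_μ sup_x |A_μ(x)|»*, *«‖A‖_α = max_μ sup_{x,x′:|x−x′|≦1} |R(U(Γ_{x,x′}))A_μ(x′) − A_μ(x)| ∕ |x−x′|^α»*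
— and this file uses their scalar READINGS `|λ| = sup_x |λ(x)|`, `‖λ‖_α = sup_{x,x′: |x−x′| ≦ 1} |R(U(Γ_{x,x′}))λ(x′) − λ(x)| ∕ |x − x′|^α` for a 𝔤-valued `λ`
(readings, not quotations); the continuation is verbatim: *«where Γ_{x,x′} is a shortest contour connecting points x and x′. It is understood that the
η-scale is used in the above definitions. If we use another scale, then it is indicated explicitly by a superscript, e.g. ‖·‖^ξ»*; (3.44)–(3.45) p. 398: the data norm on the right is `‖λ‖^{ξ′}_ε + |λ|`, `‖λ‖^{ξ′}_{β+ε} + |λ|`;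
p. 398 l. 19: *«All these inequalities are invariant with respect to gauge transformations of U.»*; Thm 3.3 p. 399 (*«λ replaced by a function J defined
at bonds»*); p. 407 l. 32–34, the sentences BEFORE Cor. 3.5: *«This allows us to prove Theorems 3.1-3.3 in some special situations, where we can use
the results of [4]. There we have proved these theorems for operators with the external gauge field configuration U = 1.»* — at `U = 1` the transport
is trivial and (3.40) is [4]'s flat Hölder quotient (2.67) p. 234 ∕ (2.137) p. 247, [I] (1.109) p. 35.

WHY THIS FILE (seat node00-def-Y g29; dag-n06-c g20 ★ LOCATED-21 (ii), lit-balaban-r06 g72 ★ LOCATED-22, ref-E g35 READ-17, fleet bus 2026-08-29∕30).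
The reader file of record `…Balaban1983to89.B9` (typing v4) reads the data norm of (3.44)∕(3.45) through the carrier field `Geometry.holder : ℝ → Loc → ℝ`,
which has no configuration argument; at NODE 00's carriers (`B9GeoNormsKLevelV1.geo9K`, `B9PinMembersKLevelV1.geo9Y`) that field is the FLAT
(`U = 1`) functional — T8's `hqTP` on site data, r03's admissible-pair functional `kGeoG.holder` on bond data (`B9GeoNormsKLevelV1.dict_holder_eq`).
Print's ‖λ‖^{ξ′}_ε of (3.40) is transported by `R(U(Γ_{x,x′}))` and so depends on `U` (LOCATED-21 (ii) ∕ LOCATED-22).  r06's COMPANION module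
`B9Ineq343to345T` re-types the Hölder block and the three theorem frames over an explicit slot `holderT : Cfg → ℝ → Loc → ℝ` (at the constant
transport it IS the v4 block, `…_const_iff`), and asks consumers to supply *«their own transported Hölder functional»*.  NODE 00's left-hand
functionals read the lifted data `λ = f ⊗ E` and take `sup_E` over the direction ball `BallY 𝔸` (def-Y's `kernelFamilyS.e4 ∕ .h2`,
`B9Ineq344GpAtLetters`), with the (3.40) quotient read by def-Y's own transported reader `hqS (par U)`.  THIS FILE supplies the matching
RIGHT-HAND functional — the inhabitant of the `holderT` slot at NODE 00's carriers — and its dictionary: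
* §1 ★ `holderSiteTY i parS U ε f := sup_{E ∈ BallY 𝔸} hqS (parS U) ε (f ⊗ E)` (sites; `hqS` = def-Y's (3.40) reader, T8's `hqTP` convention with the
  transporter), ★ `hqAB i par ε Ψ := sup_{Adm (x,x′)} t^{−ε}·‖Ψ(x) − R(U(Γ_{x,x′}))Ψ(x′)‖` (r03's admissible-pair functional `kGeoG.holder` WITH the
  transporter; print's cut «|x − x′| ≦ 1 on the ξ-lattice» verbatim, `tpar ≤ 1` on `Adm`), ★ `holderBondTY i parB U ε J := sup_E hqAB (parB U) ε (J ⊗ E)`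
  (bonds, Thm 3.3's «λ replaced by J»), and ★★ `holderTY i parS parB : CfgY 𝔸 i → ℝ → KLoc i → ℝ` (the SUM-typed slot inhabitant; `KLoc i = (geo9K i).Loc`,
  `CfgY 𝔸 i = (bg9K∕bg9Y∕bg9YR … i).Cfg` definitionally); at the letters of record ★★ `holderTYR i := holderTY i (parSymY i) (parBY i)` (the record's
  transporters, `OpsYRecordV4P.lettersYOfRecordV4P_parS ∕ _parB`).
* §2 THE `E = 𝟙` FACE (the one computation of the file): for EVERY transporter `par`, `hqS par ε (f ⊗ 𝟙) = hqTP ε f` and `hqAB par ε (J ⊗ 𝟙) = kGeoG.holder ε J`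
  (`R(u)(c𝟙) = c𝟙`: the direction `𝟙 ∈ 𝔸` is `R`-INVARIANT, `B9Eq39Adjoint.R_apply_one ∕ R_smul`; `‖c𝟙‖ = |c|` under `[NormOneClass 𝔸]`).
* §3 BOUNDEDNESS over the ball (the outer `sup_E` is a genuine supremum: `bddAbove_hqS_liftY`, `bddAbove_hqAB_liftY`, explicit majorants), hence
  ★★ DOMINATION AT EVERY CONFIGURATION `(geo9K i).holder ε λ ≤ holderTY i parS parB U ε λ` (`geo9K_holder_le_holderTY`; `[NormOneClass 𝔸]`, so that
  `𝟙 ∈ BallY 𝔸`) and ★ THE TRIVIAL-TRANSPORT FACE `holderTY i parS parB U = (geo9K i).holder` whenever `parS U`, `parB U` are trivial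
  (`holderTY_eq_geo9K_holder_of_trivial`; at the record `holderTYR i 1 = (geo9K i).holder`, `parSymY_one ∕ parBY_one`) — there the T-frames ARE the
  v4 frames (r06's `…_const_iff`).
* §4 THE TRANSFER IN THE DATA FUNCTIONAL (generic over `B9.Geometry ∕ Backgrounds ∕ KernelFamily`, bookkeeping over the companion BY NAME):
  `ineq343_345T_mono` — a pointwise LARGER data functional gives the (3.44)∕(3.45) conjuncts with the constants `B ↦ max B 0` (sign facts
  `0 ≤ len, cutH, supNorm, holder₁` as hypotheses) — and the frame forms `thm31∕33∕34PrintedT_mono`, `thm31∕33∕34PrintedT_of_printed`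
  (v4 frame + domination ⇒ T-frame).
* §5 AT NODE 00's CARRIERS: the sign facts are `B9GeoNormsKLevelV1.geo9K_holder∕supNorm∕cutH_nonneg` and `B6KLevelCensusIndexV1.len_pos`, so for EVERY
  `KIdx`-indexed carriers family `geo9 = geo9K ∘ g` (every member family `geo9Y ∘ f`, `geo9Y x = geo9K x.toKIdx`), every backgrounds family `bg`,
  every decoding `cfgOf j : (bg j).Cfg → CfgY 𝔸 (g j)` of its configurations (identity over `bg9Y ∕ bg9YR`; the BASE configuration `B9SectBGpReadingsY.baseY`
  over dag-n06-c's coded carriers — print's Thm 3.4 bounds `G′(U′U)` in the norms OF `U`, R13-U1) and every pair of transporter letters: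
  ★★★ `thm31PrintedT_holderTY_of_printed : Thm31Printed c35 (geo9K ∘ g) bg Gp → Thm31PrintedT c35 (geo9K ∘ g) bg Gp (fun j W => holderTY (g j) parS parB (cfgOf j W))`,
  and `thm33… ∕ thm34…` likewise.  READING: every landed v4 conclusion about NODE 00's instance (the N06 certificate editions conclude `B9LeafX`, whose
  `t31 ∕ t33 ∕ t34` are the v4 frames over `geo9Y ∘ f`) already yields print's T-form WITH NODE 00's TRANSPORTED FUNCTIONAL — ref-E READ-17 (c)
  («v4 ⇒ T needs a transport that DOMINATES g.holder pointwise») is met at NODE 00 by §3; no certificate edition changes, no binder changes.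
* §6 AT THE [B9] CARRIER BUNDLE OVER THE CODED CARRIER (def-Y's `carriersYU P G f b ιB C38 ops`; at the record `Y9OfRecordUPb N θ Mstar ops f b ιB C38`,
  the N06 certificate editions' conclusion object): ★★ `holderTYC i := holderTYR i ∘ baseY i` on coded configurations and ★★★
  `thm31∕33∕34T_holderTYC_of_b9Leaf_carriersYU`, `thmsT_holderTYC_of_b9LeafX_carriersYU`, `thmsT_holderTYC_of_b9LeafX_record :
  B9LeafX (Y9OfRecordUPb …) → Thm31PrintedT c35Y (geo9Y ∘ f) … holderTYC ∧ Thm33PrintedT … ∧ Thm34PrintedT …` (carriers written as the bundle's field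
  values, `carriersYU_c35 ∕ _geo9 ∕ _bg9`, `rfl`; `[NormOneClass (Matrix (Fin N) (Fin N) ℂ)]` supplied by the caller as in the certificate files).
* §7 (EDITION v1.1, dag-n06-c g21 `LOCATED22-ADOPTION-MEMO-g21.md` §5 bullet 2 ∕ §6 (iv): what a coordinate READING of (3.40) in a frame `b : κ → 𝔸` — the
  reading lemmas «transported input class `loc ≤ holderT U ε λ + |λ|`» — consumes from this file).  ★★ ANY LIFT DIRECTION: `unitDirY E := ‖E‖⁻¹E ∈ BallY 𝔸`,
  `liftY_eq_norm_smul_unitDirY`, and `hqS (parS U) ε (f ⊗ E) ≤ ‖E‖·holderSiteTY`, `hqAB (parB U) ε (J ⊗ E) ≤ ‖E‖·holderBondTY` for EVERY `E : 𝔸`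
  (`hqS∕hqAB_liftY_le_norm_mul_holderSiteTY∕BondTY∕holderTY`; homogeneity in the direction, `R_smul`).  ★★ THE PLAIN-TAXI INSTANCE `holderTYP i := holderTY i
  (parSY i) (parBY i)` — the UNSYMMETRISED site table, i.e. DEFINITIONALLY dag-n06-l's tables of the transported classes (`B9GradViaDivLettersTransported.taxiS i bg
  cfg U₁ = parSY i (cfg U₁)`, `taxiB i bg cfg U₁ x x′ = parBY i (cfg U₁) x.src x′.src`, both literally `parTaxiV (cfg U₁) …`; `rfl` at a consumer holding both
  files — this file does not import dag-n06-l's) — with `geo9K_holder_le_holderTYP`, `holderTYP_one`, `holderTYPC := holderTYP ∘ baseY` (`_base ∕ _prod`), and the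
  leaf ∕ record T-forms FOR EVERY TABLE PAIR `thmsT_holderTYtab_of_b9LeafX_carriersYU ∕ _record` (conclusion data norm `W ↦ holderTY (parS j) (parB j) (base W)`;
  §6 is the instance `parSymY ∕ parBY`) and the plain-taxi corollaries `thmsT_holderTYPC_of_b9LeafX_carriersYU ∕ _record`.  `holderTYR` (R7-symmetrised sites)
  and `holderTYP` differ only on lexicographically decreasing site pairs, by the change of shortest contour; which instance a T-frame adoption pins is the
  adopter's choice — both dominate `geo9K.holder`, both have the `U = 1` face, both carry v4 ⇒ T.

LOCATED (honest, for referees).  (a) The domination of §3 is a fact about NODE 00's READING of (3.39): the direction ball `BallY 𝔸` of the product-form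
lift (`OpsYOfLetters` §1) is the closed unit ball of the ambient algebra `𝔸` (at the record `M_N(ℂ)`), which contains the `R`-invariant direction `𝟙`;
print's `λ` is 𝔤-valued and 𝔤 = su(N) has no such direction.  The LEFT-hand functionals of NODE 00 (`kernelFamilyS ∕ kernelFamilyB`) take the same
`sup_E` over the same ball, so the T-form concluded in §5 is print's (3.44)∕(3.45) at NODE 00's reading with matching direction ranges on both sides;
nothing is claimed about a 𝔤-restricted direction ball.  (b) The v4 conclusions remain in the tree and remain the STRONGER statement at `U ≠ 1`
(flat data norm on the right); this file only adds the print-shaped consequence.  (c) LOCATED-21 (i) — the flat INPUT conjuncts `h44m ∕ h45X ∕ h45Y ∕ h44G ∕ hp45W`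
of the certificate's rows 20–21 and their transported input classes (dag-n06-l's `B9SmoothHolderClassP.bHZP∕bHZKP (taxiS∕taxiB U)`, dag-n06-c's
`B9SmoothHolderClassPI`) — is a different object on a different road (BlockNorms on coordinate spaces `XSK κ i → ℝ`), neither used nor touched here.
(d) The site summand reads ALL pairs of the member torus (def-Y's uncut `hqS`, census `OpsYHolderFar`), the bond summand only r03's admissible pairs —
exactly as the v4 field does (`hqTP` uncut, `kGeoG.holder` cut), so the trivial-transport face is literal.

HONEST SCOPE.  Definitions + elementary bookkeeping (`iSup` over a finite pair type and over the ball, `R_apply_one ∕ R_smul`, `norm_smul`, monotonicity of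
products of non-negative reals); nothing of [B9] Thms 3.1–3.4 is asserted or proved; no operator is constructed; COUNT-NEUTRAL; N06 NOT discharged; one
finite 𝕋^{d+1} programme at fixed ε — nothing continuum, nothing about OS positivity or the mass gap.  Cell `pub-ymgap` (HUMAN RULING D-0062), Track A node
N06 [B9] row 13, seat `pub-ymgap-node00-def-Y` (g29), 2026-08-30; EDITION v1.1 of the file landed as p753664 (v1.0 §0–§6 byte-identical in their
declarations; v1.1 = §7 + three doc-only quotation repairs of lit-balaban-r06's landing note and ref-E's READ-6 NIT-info); no `sorry`, no `axiom`, no `instance`, no `notation`.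

RELATED IN THE TREE, NOT DUPLICATED (used BY NAME): `Node00.OpsYOfLetters` (`hqS`, `liftY`, `BallY`, `SiteParY`, `BondParY`, `iSup_ite_le_iSup_ite`,
`norm_liftY_le`), `Node00.OpsYHolderFar` (`denS`, `hqS_nonneg`, `hqS_le_of_forall`), `Node00.OpsYTransport ∕ OpsYRecordV4` (`parBY`, `parSymY`, their `U = 1`
faces), `B9Cor35ComparisonsGpCAtLetters.hqS_one_liftY_le ∕ liftY_sub_apply ∕ norm_real_smul_ball_le` (the `U = 1`, any-`E` half of the flat face),
`B9Thm314WholeReadingLattice.norm_R_le`, `B9Ineq343to345T` (r06's companion frames and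
their `_const_iff`), `B9GeoNormsKLevelV1` (§6 sign facts), `B6KLevelCensusIndexV1` (`Adm`, `tpar`, `kGeoG`), `B6Prop22KLevelTorusCensusEta.hqTP`.
NOT this file: def-Y's ζ-cut bond reader `holderQB` (the (3.43)∕(3.45) OUTPUT words, η-normalised pair weight) and the coordinate-space input classes of
(c) above.
-/

noncomputable section

namespace Literature.MathematicalPhysics.QuantumFieldTheory.Balaban1983to89.Node00.OpsYHolderT

open LatticeFieldCalculus (supDist)
open B4TorusKernel.MultiPeriod (torusSupNorm torusSupNorm_nonneg)
open B6GlobalChartV1 (PV)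
open B6KLevelCensusIndexV1 (KIdx Adm tpar tpar_nonneg kGeoG)
open B6Prop22KLevelTorusCensusEta (hqTP hqTP_nonneg nKT nKT_pos)
open B9Eq39Adjoint (R R_apply_one R_smul R_one R_zero)
open B9Thm314WholeReadingLattice (norm_R_le)
open B9GeoNormsKLevelV1 (geo9K geo9K_holder_nonneg geo9K_supNorm_nonneg geo9K_cutH_nonneg)
open B9PinMembersKLevelV1 (MemberY geo9Y)
open B9 (Geometry Backgrounds KernelFamily Ineq342_346_347 Ineq343_345 Thm31Printed Thm33Printed Thm34Printed)
open B9Ineq343to345T (Ineq343_345T ineq343_345T_const_iff Thm31PrintedT thm31PrintedT_const_iff Thm33PrintedT thm33PrintedT_const_iff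
  Thm34PrintedT thm34PrintedT_const_iff)
open B9Cor35ComparisonsGpCAtLetters (hqS_one_liftY_le liftY_sub_apply norm_real_smul_ball_le)
open Node00.OpsYHolderFar (denS denS_nonneg hqS_nonneg hqS_le_of_forall pair_le_hqS)

variable {d ℓ : ℕ} {hd : 1 ≤ d + 1} {hL : Odd (ℓ + 1) ∧ 1 < ℓ + 1} {b₀ b₁ : ℝ} {Mstar : ℕ}
variable {𝔸 : Type} [NormedRing 𝔸] [NormedAlgebra ℂ 𝔸] [CompleteSpace 𝔸]

/-! ## §0 Algebra of the transport of a lift (the `R`-invariant direction `𝟙`) -/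

section Algebra

omit [CompleteSpace 𝔸] in
/-- **the direction `𝟙` is `R`-invariant on lifts**: `R(u)((f ⊗ 𝟙)(z)) = (f ⊗ 𝟙)(z)` (`R(u)(c·𝟙) = c·u𝟙u⁻¹ = c·𝟙`).
[cite: Balaban1985BackgroundPropagators, p.390 (after (3.1): «Let us recall that R(U)X = UXU⁻¹»), bookkeeping] -/
theorem R_liftY_one_apply {X : Type} (u : 𝔸ˣ) (f : X → ℝ) (z : X) : R u (liftY f (1 : 𝔸) z) = liftY f (1 : 𝔸) z := by
  rw [liftY_apply, R_smul, R_apply_one]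

omit [CompleteSpace 𝔸] in
/-- `‖(f ⊗ 𝟙)(z′) − (f ⊗ 𝟙)(z)‖ = |f z′ − f z|` under `‖𝟙‖ = 1`. [cite: Balaban1985BackgroundPropagators, (3.39) p.397, bookkeeping] -/
theorem norm_liftY_one_sub [NormOneClass 𝔸] {X : Type} (f : X → ℝ) (z z' : X) :
    ‖liftY f (1 : 𝔸) z' - liftY f (1 : 𝔸) z‖ = |f z' - f z| := by
  rw [liftY_sub_apply, norm_smul, norm_one, mul_one, Complex.norm_real, Real.norm_eq_abs]

/-- the transported covariant difference of a lift along a ball direction is bounded by point terms: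
`‖R(u)(f ⊗ E)(z′) − (f ⊗ E)(z)‖ ≤ ‖u‖·‖u⁻¹‖·|f z′| + |f z|` (`‖R(u)X‖ ≤ ‖u‖‖u⁻¹‖‖X‖`: `B9Thm314WholeReadingLattice.norm_R_le`, by name).
[cite: Balaban1985BackgroundPropagators, (3.40) p.397, bookkeeping] -/
theorem norm_R_liftY_sub_liftY_le {X : Type} (u : 𝔸ˣ) (f : X → ℝ) (E : BallY 𝔸) (z z' : X) :
    ‖R u (liftY f (E : 𝔸) z') - liftY f (E : 𝔸) z‖ ≤ ‖(u : 𝔸)‖ * ‖((u⁻¹ : 𝔸ˣ) : 𝔸)‖ * |f z'| + |f z| :=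
  (norm_sub_le _ _).trans (add_le_add ((norm_R_le u _).trans
    (mul_le_mul_of_nonneg_left (norm_liftY_le f E z') (mul_nonneg (norm_nonneg _) (norm_nonneg _)))) (norm_liftY_le f E z))

/-- the same with the transport on the subtrahend: `‖(f ⊗ E)(x) − R(u)(f ⊗ E)(x′)‖ ≤ |f x| + ‖u‖·‖u⁻¹‖·|f x′|`.
[cite: Balaban1985BackgroundPropagators, (3.40) p.397, bookkeeping] -/
theorem norm_liftY_sub_R_liftY_le {X : Type} (u : 𝔸ˣ) (f : X → ℝ) (E : BallY 𝔸) (x x' : X) :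
    ‖liftY f (E : 𝔸) x - R u (liftY f (E : 𝔸) x')‖ ≤ |f x| + ‖(u : 𝔸)‖ * ‖((u⁻¹ : 𝔸ˣ) : 𝔸)‖ * |f x'| :=
  (norm_sub_le _ _).trans (add_le_add (norm_liftY_le f E x) ((norm_R_le u _).trans
    (mul_le_mul_of_nonneg_left (norm_liftY_le f E x') (mul_nonneg (norm_nonneg _) (norm_nonneg _)))))

omit [NormedAlgebra ℂ 𝔸] [CompleteSpace 𝔸] in
/-- `𝟙` lies in the direction ball under `‖𝟙‖ = 1`. [cite: Balaban1985BackgroundPropagators, (3.39) p.397, dictionary (NODE 00's 𝔸-ball reading)] -/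
theorem one_mem_ballY [NormOneClass 𝔸] : (1 : 𝔸) ∈ Metric.closedBall (0 : 𝔸) 1 :=
  mem_closedBall_zero_iff.2 (le_of_eq norm_one)

end Algebra

/-- the direction `𝟙` as a point of `BallY 𝔸`. [cite: Balaban1985BackgroundPropagators, (3.39) p.397, dictionary (NODE 00's 𝔸-ball reading)] -/
def oneBallY [NormOneClass 𝔸] : BallY 𝔸 := ⟨1, one_mem_ballY⟩

/-- its value is `𝟙`. [cite: Balaban1985BackgroundPropagators, (3.39) p.397, bookkeeping] -/
@[simp] theorem oneBallY_coe [NormOneClass 𝔸] : ((oneBallY : BallY 𝔸) : 𝔸) = 1 := rfl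

variable (i : KIdx d ℓ hd hL b₀ b₁)

/-! ## §1 The transported Hölder data norm of lifted data -/

/-- ★ **(3.40) of the lifted SITE data `f ⊗ E`, transported by `U(Γ_{z,z′}) = parS U z z′`, sup over the direction ball**:
`‖f‖^{U}_ε := sup_{E ∈ BallY 𝔸} sup_{z ≠ z′} ‖R(U(Γ_{z,z′}))(f ⊗ E)(z′) − (f ⊗ E)(z)‖ ∕ (η|z′ − z|_T)^ε` (def-Y's reader `hqS`).
[cite: Balaban1985BackgroundPropagators, (3.40) p.397, (3.44)–(3.45) p.398 (the data norm ‖λ‖^{ξ′}_ε)] -/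
def holderSiteTY (parS : SiteParY 𝔸 i) (U : CfgY 𝔸 i) (ε : ℝ) (f : SiteY i → ℝ) : ℝ :=
  ⨆ E : BallY 𝔸, hqS i (parS U) ε (liftY f (E : 𝔸))

/-- ★ **(3.40) on the BOND sector over r03's ADMISSIBLE pairs, WITH the transporter**: `sup_{Adm (x,x′)} t(x,x′)^{−ε}·‖Ψ(x) − R(U(Γ_{x,x′}))Ψ(x′)‖`
(`t = |x − x′|_∞ ∕ L^{j(y(x))} ≤ 1`: print's cut «|x − x′| ≦ 1» at the scale `ξ = L^{−j}`; r03's `kGeoG.holder` is the case `R = id`; the admissible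
DIAGONAL `x = x′` carries the weight `t^{−ε} = 0^{−ε} = 0` for `ε ≠ 0` (`Real.zero_rpow`), so it reads `0` exactly as in r03's functional — ref-E READ-6 NIT-info).
[cite: Balaban1985BackgroundPropagators, (3.40) p.397, Thm 3.3 p.399 («λ replaced by a function J defined at bonds»); Balaban1984PropagatorsII, (2.137) p.247] -/
def hqAB (par : Site (PV d ℓ i.m i.K hd hL) 0 → Site (PV d ℓ i.m i.K hd hL) 0 → 𝔸ˣ) (ε : ℝ) (Ψ : FBondY i → 𝔸) : ℝ :=
  ⨆ q : FBondY i × FBondY i, if Adm i q.1 q.2 then tpar i q.1 q.2 ^ (-ε) * ‖Ψ q.1 - R (par q.1.src q.2.src) (Ψ q.2)‖ else 0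

/-- ★ **(3.40) of the lifted BOND data `J ⊗ E`, transported by `parB U`, sup over the direction ball**: `‖J‖^{U}_ε := sup_E hqAB (parB U) ε (J ⊗ E)`.
[cite: Balaban1985BackgroundPropagators, (3.40) p.397, Thm 3.3 p.399] -/
def holderBondTY (parB : BondParY 𝔸 i) (U : CfgY 𝔸 i) (ε : ℝ) (J : FBondY i → ℝ) : ℝ :=
  ⨆ E : BallY 𝔸, hqAB i (parB U) ε (liftY J (E : 𝔸))

/-- ★★ **THE TRANSPORTED HÖLDER DATA NORM AT NODE 00** — the inhabitant of the companion's slot `holderT : Cfg → ℝ → Loc → ℝ` at the carriers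
`(geo9K i, CfgY 𝔸 i)` (`(geo9K i).Loc = KLoc i`): site data through `holderSiteTY`, bond data through `holderBondTY`.
[cite: Balaban1985BackgroundPropagators, (3.40) p.397, (3.44)–(3.45) p.398, Thm 3.3 p.399] -/
def holderTY (parS : SiteParY 𝔸 i) (parB : BondParY 𝔸 i) : CfgY 𝔸 i → ℝ → KLoc i → ℝ := fun U ε lam =>
  match lam with
  | .inl f => holderSiteTY i parS U ε f
  | .inr J => holderBondTY i parB U ε J

/-- site face. [cite: Balaban1985BackgroundPropagators, (3.40) p.397, bookkeeping] -/
@[simp] theorem holderTY_inl (parS : SiteParY 𝔸 i) (parB : BondParY 𝔸 i) (U : CfgY 𝔸 i) (ε : ℝ) (f : SiteY i → ℝ) :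
    holderTY i parS parB U ε (.inl f) = holderSiteTY i parS U ε f := rfl

/-- bond face. [cite: Balaban1985BackgroundPropagators, (3.40) p.397, bookkeeping] -/
@[simp] theorem holderTY_inr (parS : SiteParY 𝔸 i) (parB : BondParY 𝔸 i) (U : CfgY 𝔸 i) (ε : ℝ) (J : FBondY i → ℝ) :
    holderTY i parS parB U ε (.inr J) = holderBondTY i parB U ε J := rfl

/-- ★★ **AT THE LETTERS OF RECORD**: the transported Hölder data norm with NODE 00's transporters of record — the symmetrised taxicab site transporter
`parSymY` and the bond transporter `parBY` (the letters `parS ∕ parB` of `OpsYRecordV4P.lettersYOfRecordV4P`).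
[cite: Balaban1985BackgroundPropagators, (3.40) p.397 («Γ_{x,x′} a shortest contour»), (3.19) p.393] -/
def holderTYR : CfgY 𝔸 i → ℝ → KLoc i → ℝ := holderTY i (parSymY i) (parBY i)

/-- `holderTYR` unfolded (`rfl`). [cite: Balaban1985BackgroundPropagators, (3.40) p.397, bookkeeping] -/
theorem holderTYR_eq : holderTYR (𝔸 := 𝔸) i = holderTY i (parSymY i) (parBY i) := rfl

/-! ## §2 The v4 field, and the `E = 𝟙` face of the transported quotients -/

/-- the v4 field on SITE data IS T8's flat Hölder seminorm `hqTP` (`rfl`). [cite: Balaban1985BackgroundPropagators, (3.40) p.397 at U = 1; Balaban1984PropagatorsII, (2.67) p.234] -/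
theorem geo9K_holder_inl (ε : ℝ) (f : SiteY i → ℝ) : (geo9K i).holder ε (Sum.inl f) = hqTP (toKT i) ε f := rfl

/-- the v4 field on BOND data IS r03's admissible-pair functional (`rfl`). [cite: Balaban1985BackgroundPropagators, (3.40) p.397 at U = 1; Balaban1984PropagatorsII, (2.137) p.247] -/
theorem geo9K_holder_inr (ε : ℝ) (J : FBondY i → ℝ) : (geo9K i).holder ε (Sum.inr J) = (kGeoG i).holder ε J := rfl

section EOne

variable [NormOneClass 𝔸]

omit [CompleteSpace 𝔸] in
/-- ★ **`E = 𝟙`, sites, ANY transporter**: `hqS par ε (f ⊗ 𝟙) = hqTP ε f` — along the `R`-invariant direction the transport drops out and (3.40) is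
[4]'s flat quotient. [cite: Balaban1985BackgroundPropagators, (3.40) p.397; Balaban1984PropagatorsII, (2.67) p.234] -/
theorem hqS_liftY_one (par : SiteY i → SiteY i → 𝔸ˣ) (ε : ℝ) (f : SiteY i → ℝ) :
    hqS i par ε (liftY f (1 : 𝔸)) = hqTP (toKT i) ε f := by
  classical
  unfold hqS hqTP
  refine congrArg iSup (funext fun p => ?_)
  split_ifs with hp
  · rw [R_liftY_one_apply, norm_liftY_one_sub]
  · rfl

omit [CompleteSpace 𝔸] in
/-- ★ **`E = 𝟙`, bonds, ANY transporter**: `hqAB par ε (J ⊗ 𝟙) = kGeoG.holder ε J`. [cite: Balaban1985BackgroundPropagators, (3.40) p.397; Balaban1984PropagatorsII, (2.137) p.247] -/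
theorem hqAB_liftY_one (par : Site (PV d ℓ i.m i.K hd hL) 0 → Site (PV d ℓ i.m i.K hd hL) 0 → 𝔸ˣ) (ε : ℝ) (J : FBondY i → ℝ) :
    hqAB i par ε (liftY J (1 : 𝔸)) = (kGeoG i).holder ε J := by
  unfold hqAB
  refine congrArg iSup (funext fun q => ?_)
  split_ifs with hq
  · rw [R_liftY_one_apply, norm_liftY_one_sub]
  · rfl

end EOne

/-! ## §3 Boundedness over the ball, domination of the v4 field, the trivial-transport face -/

/-- an `E`-free majorant of the site quotients of `f ⊗ E` along the ball. [cite: Balaban1985BackgroundPropagators, (3.40) p.397, bookkeeping] -/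
def majS (par : SiteY i → SiteY i → 𝔸ˣ) (ε : ℝ) (f : SiteY i → ℝ) : ℝ :=
  ⨆ p : SiteY i × SiteY i, (‖(par p.1 p.2 : 𝔸)‖ * ‖(((par p.1 p.2)⁻¹ : 𝔸ˣ) : 𝔸)‖ * |f p.2| + |f p.1|) / denS i ε p.1 p.2

omit [NormedAlgebra ℂ 𝔸] [CompleteSpace 𝔸] in
/-- `0 ≤ majS`. [cite: Balaban1985BackgroundPropagators, (3.40) p.397, bookkeeping] -/
theorem majS_nonneg (par : SiteY i → SiteY i → 𝔸ˣ) (ε : ℝ) (f : SiteY i → ℝ) : 0 ≤ majS i par ε f :=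
  Real.iSup_nonneg fun p => div_nonneg (by positivity) (denS_nonneg i ε p.1 p.2)

/-- every ball direction's site quotient sup is below the majorant. [cite: Balaban1985BackgroundPropagators, (3.40) p.397, bookkeeping] -/
theorem hqS_liftY_le_majS (par : SiteY i → SiteY i → 𝔸ˣ) (ε : ℝ) (f : SiteY i → ℝ) (E : BallY 𝔸) :
    hqS i par ε (liftY f (E : 𝔸)) ≤ majS i par ε f := by
  refine hqS_le_of_forall i par ε _ (majS_nonneg i par ε f) fun z z' _ => ?_
  refine le_trans ?_ (le_ciSup (Set.finite_range _).bddAbove (z, z'))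
  exact div_le_div_of_nonneg_right (norm_R_liftY_sub_liftY_le (par z z') f E z z') (denS_nonneg i ε z z')

/-- the site quotient sups along the ball are bounded above (so `holderSiteTY` is a genuine supremum).
[cite: Balaban1985BackgroundPropagators, (3.40) p.397, bookkeeping] -/
theorem bddAbove_hqS_liftY (par : SiteY i → SiteY i → 𝔸ˣ) (ε : ℝ) (f : SiteY i → ℝ) :
    BddAbove (Set.range fun E : BallY 𝔸 => hqS i par ε (liftY f (E : 𝔸))) :=
  ⟨majS i par ε f, by rintro _ ⟨E, rfl⟩; exact hqS_liftY_le_majS i par ε f E⟩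

omit [NormedAlgebra ℂ 𝔸] [CompleteSpace 𝔸] in
/-- `0 ≤ hqAB`. [cite: Balaban1985BackgroundPropagators, (3.40) p.397, bookkeeping] -/
theorem hqAB_nonneg (par : Site (PV d ℓ i.m i.K hd hL) 0 → Site (PV d ℓ i.m i.K hd hL) 0 → 𝔸ˣ) (ε : ℝ) (Ψ : FBondY i → 𝔸) :
    0 ≤ hqAB i par ε Ψ := by
  unfold hqAB
  refine Real.iSup_nonneg fun q => ?_
  split_ifs
  · exact mul_nonneg (Real.rpow_nonneg (tpar_nonneg i _ _) _) (norm_nonneg _)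
  · exact le_rfl

omit [NormedAlgebra ℂ 𝔸] [CompleteSpace 𝔸] in
/-- every ADMISSIBLE pair is below `hqAB`. [cite: Balaban1985BackgroundPropagators, (3.40) p.397; Balaban1984PropagatorsII, (2.137) p.247, bookkeeping] -/
theorem pair_le_hqAB (par : Site (PV d ℓ i.m i.K hd hL) 0 → Site (PV d ℓ i.m i.K hd hL) 0 → 𝔸ˣ) (ε : ℝ) (Ψ : FBondY i → 𝔸)
    {x x' : FBondY i} (hadm : Adm i x x') :
    tpar i x x' ^ (-ε) * ‖Ψ x - R (par x.src x'.src) (Ψ x')‖ ≤ hqAB i par ε Ψ := by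
  unfold hqAB
  refine le_ciSup_of_le (Finite.bddAbove_range _) (x, x') ?_
  dsimp only
  rw [if_pos hadm]

omit [NormedAlgebra ℂ 𝔸] [CompleteSpace 𝔸] in
/-- intro rule over ADMISSIBLE pairs: a bound `B ≥ 0` at every `Adm` pair bounds `hqAB`. [cite: Balaban1985BackgroundPropagators, (3.40) p.397; Balaban1984PropagatorsII, (2.137) p.247, bookkeeping] -/
theorem hqAB_le_of_forall_adm (par : Site (PV d ℓ i.m i.K hd hL) 0 → Site (PV d ℓ i.m i.K hd hL) 0 → 𝔸ˣ) (ε : ℝ) (Ψ : FBondY i → 𝔸)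
    {B : ℝ} (hB : 0 ≤ B) (h : ∀ x x' : FBondY i, Adm i x x' → tpar i x x' ^ (-ε) * ‖Ψ x - R (par x.src x'.src) (Ψ x')‖ ≤ B) :
    hqAB i par ε Ψ ≤ B := by
  unfold hqAB
  refine Real.iSup_le (fun q => ?_) hB
  split_ifs with hadm
  · exact h q.1 q.2 hadm
  · exact hB

/-- an `E`-free majorant of the bond quotients of `J ⊗ E` along the ball. [cite: Balaban1985BackgroundPropagators, (3.40) p.397, bookkeeping] -/
def majB (par : Site (PV d ℓ i.m i.K hd hL) 0 → Site (PV d ℓ i.m i.K hd hL) 0 → 𝔸ˣ) (ε : ℝ) (J : FBondY i → ℝ) : ℝ :=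
  ⨆ q : FBondY i × FBondY i,
    tpar i q.1 q.2 ^ (-ε) * (|J q.1| + ‖(par q.1.src q.2.src : 𝔸)‖ * ‖(((par q.1.src q.2.src)⁻¹ : 𝔸ˣ) : 𝔸)‖ * |J q.2|)

omit [NormedAlgebra ℂ 𝔸] [CompleteSpace 𝔸] in
/-- `0 ≤ majB`. [cite: Balaban1985BackgroundPropagators, (3.40) p.397, bookkeeping] -/
theorem majB_nonneg (par : Site (PV d ℓ i.m i.K hd hL) 0 → Site (PV d ℓ i.m i.K hd hL) 0 → 𝔸ˣ) (ε : ℝ) (J : FBondY i → ℝ) :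
    0 ≤ majB i par ε J :=
  Real.iSup_nonneg fun q => mul_nonneg (Real.rpow_nonneg (tpar_nonneg i _ _) _) (by positivity)

/-- every ball direction's bond quotient sup is below the majorant. [cite: Balaban1985BackgroundPropagators, (3.40) p.397, bookkeeping] -/
theorem hqAB_liftY_le_majB (par : Site (PV d ℓ i.m i.K hd hL) 0 → Site (PV d ℓ i.m i.K hd hL) 0 → 𝔸ˣ) (ε : ℝ) (J : FBondY i → ℝ)
    (E : BallY 𝔸) : hqAB i par ε (liftY J (E : 𝔸)) ≤ majB i par ε J := by
  refine hqAB_le_of_forall_adm i par ε _ (majB_nonneg i par ε J) fun x x' _ => ?_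
  refine le_trans ?_ (le_ciSup (Set.finite_range _).bddAbove (x, x'))
  exact mul_le_mul_of_nonneg_left (norm_liftY_sub_R_liftY_le (par x.src x'.src) J E x x') (Real.rpow_nonneg (tpar_nonneg i _ _) _)

/-- the bond quotient sups along the ball are bounded above (so `holderBondTY` is a genuine supremum).
[cite: Balaban1985BackgroundPropagators, (3.40) p.397, bookkeeping] -/
theorem bddAbove_hqAB_liftY (par : Site (PV d ℓ i.m i.K hd hL) 0 → Site (PV d ℓ i.m i.K hd hL) 0 → 𝔸ˣ) (ε : ℝ) (J : FBondY i → ℝ) :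
    BddAbove (Set.range fun E : BallY 𝔸 => hqAB i par ε (liftY J (E : 𝔸))) :=
  ⟨majB i par ε J, by rintro _ ⟨E, rfl⟩; exact hqAB_liftY_le_majB i par ε J E⟩

/-- `0 ≤ holderSiteTY`. [cite: Balaban1985BackgroundPropagators, (3.40) p.397, bookkeeping] -/
theorem holderSiteTY_nonneg (parS : SiteParY 𝔸 i) (U : CfgY 𝔸 i) (ε : ℝ) (f : SiteY i → ℝ) : 0 ≤ holderSiteTY i parS U ε f :=
  Real.iSup_nonneg fun _ => hqS_nonneg i (parS U) ε _

/-- `0 ≤ holderBondTY`. [cite: Balaban1985BackgroundPropagators, (3.40) p.397, bookkeeping] -/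
theorem holderBondTY_nonneg (parB : BondParY 𝔸 i) (U : CfgY 𝔸 i) (ε : ℝ) (J : FBondY i → ℝ) : 0 ≤ holderBondTY i parB U ε J :=
  Real.iSup_nonneg fun _ => hqAB_nonneg i (parB U) ε _

/-- `0 ≤ holderTY`. [cite: Balaban1985BackgroundPropagators, (3.40) p.397, bookkeeping] -/
theorem holderTY_nonneg (parS : SiteParY 𝔸 i) (parB : BondParY 𝔸 i) (U : CfgY 𝔸 i) (ε : ℝ) (lam : KLoc i) :
    0 ≤ holderTY i parS parB U ε lam := by
  cases lam with
  | inl f => exact holderSiteTY_nonneg i parS U ε f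
  | inr J => exact holderBondTY_nonneg i parB U ε J

/-- every direction is below the site sup. [cite: Balaban1985BackgroundPropagators, (3.40) p.397, bookkeeping] -/
theorem hqS_liftY_le_holderSiteTY (parS : SiteParY 𝔸 i) (U : CfgY 𝔸 i) (ε : ℝ) (f : SiteY i → ℝ) (E : BallY 𝔸) :
    hqS i (parS U) ε (liftY f (E : 𝔸)) ≤ holderSiteTY i parS U ε f :=
  le_ciSup (bddAbove_hqS_liftY i (parS U) ε f) E

/-- every direction is below the bond sup. [cite: Balaban1985BackgroundPropagators, (3.40) p.397, bookkeeping] -/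
theorem hqAB_liftY_le_holderBondTY (parB : BondParY 𝔸 i) (U : CfgY 𝔸 i) (ε : ℝ) (J : FBondY i → ℝ) (E : BallY 𝔸) :
    hqAB i (parB U) ε (liftY J (E : 𝔸)) ≤ holderBondTY i parB U ε J :=
  le_ciSup (bddAbove_hqAB_liftY i (parB U) ε J) E

/-- the record's site transporter at `U = 1` is trivial, as a function. [cite: Balaban1985BackgroundPropagators, Cor. 3.5 p.407 (U = 1), bookkeeping] -/
theorem parSymY_one_eq : parSymY (𝔸 := 𝔸) i (fun _ _ => 1) = fun _ _ => 1 :=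
  funext fun z => funext fun w => parSymY_one i z w

/-- the record's bond transporter at `U = 1` is trivial, as a function. [cite: Balaban1985BackgroundPropagators, Cor. 3.5 p.407 (U = 1), bookkeeping] -/
theorem parBY_one_eq : parBY (𝔸 := 𝔸) i (fun _ _ => 1) = fun _ _ => 1 :=
  funext fun s => funext fun s' => parBY_one i s s'

section Domination

variable [NormOneClass 𝔸]

/-- ★★ **DOMINATION, sites, EVERY configuration**: `hqTP ε f ≤ ‖f‖^{U}_ε` (the direction `E = 𝟙`). [cite: Balaban1985BackgroundPropagators, (3.40) p.397, (3.44)–(3.45) p.398; NODE 00's 𝔸-ball reading of (3.39)] -/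
theorem hqTP_le_holderSiteTY (parS : SiteParY 𝔸 i) (U : CfgY 𝔸 i) (ε : ℝ) (f : SiteY i → ℝ) :
    hqTP (toKT i) ε f ≤ holderSiteTY i parS U ε f := by
  rw [← hqS_liftY_one i (parS U) ε f]
  exact hqS_liftY_le_holderSiteTY i parS U ε f oneBallY

/-- ★★ **DOMINATION, bonds, EVERY configuration**: `kGeoG.holder ε J ≤ ‖J‖^{U}_ε`. [cite: Balaban1985BackgroundPropagators, (3.40) p.397, Thm 3.3 p.399; NODE 00's 𝔸-ball reading of (3.39)] -/
theorem kGeoG_holder_le_holderBondTY (parB : BondParY 𝔸 i) (U : CfgY 𝔸 i) (ε : ℝ) (J : FBondY i → ℝ) :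
    (kGeoG i).holder ε J ≤ holderBondTY i parB U ε J := by
  rw [← hqAB_liftY_one i (parB U) ε J]
  exact hqAB_liftY_le_holderBondTY i parB U ε J oneBallY

/-- ★★★ **DOMINATION OF THE v4 FIELD AT EVERY CONFIGURATION**: `(geo9K i).holder ε λ ≤ holderTY i parS parB U ε λ` — the transported data norm of
NODE 00 is pointwise at least the flat one, for every `U` and every pair of transporter letters (ref-E READ-17 (c)'s condition for «v4 ⇒ T»).
[cite: Balaban1985BackgroundPropagators, (3.40) p.397, (3.44)–(3.45) p.398; NODE 00's 𝔸-ball reading of (3.39)] -/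
theorem geo9K_holder_le_holderTY (parS : SiteParY 𝔸 i) (parB : BondParY 𝔸 i) (U : CfgY 𝔸 i) (ε : ℝ) (lam : KLoc i) :
    (geo9K i).holder ε lam ≤ holderTY i parS parB U ε lam := by
  cases lam with
  | inl f => exact hqTP_le_holderSiteTY i parS U ε f
  | inr J => exact kGeoG_holder_le_holderBondTY i parB U ε J

/-- at the letters of record. [cite: Balaban1985BackgroundPropagators, (3.40) p.397, (3.44)–(3.45) p.398] -/
theorem geo9K_holder_le_holderTYR (U : CfgY 𝔸 i) (ε : ℝ) (lam : KLoc i) : (geo9K i).holder ε lam ≤ holderTYR i U ε lam :=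
  geo9K_holder_le_holderTY i (parSymY i) (parBY i) U ε lam

/-- at a member: `(geo9Y x).holder ≤ holderTYR x.toKIdx U`. [cite: Balaban1985BackgroundPropagators, (3.40) p.397, (3.44)–(3.45) p.398] -/
theorem geo9Y_holder_le_holderTYR (x : MemberY d ℓ hd hL b₀ b₁ Mstar) (U : CfgY 𝔸 x.toKIdx) (ε : ℝ) (lam : KLoc x.toKIdx) :
    (geo9Y x).holder ε lam ≤ holderTYR x.toKIdx U ε lam :=
  geo9K_holder_le_holderTYR x.toKIdx U ε lam

/-- ★ **THE TRIVIAL-TRANSPORT FACE, sites**: if `parS U` is trivial then `‖f‖^{U}_ε = hqTP ε f` (`≤`: every ball direction, r06∕def-Y's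
`hqS_one_liftY_le`; `≥`: the direction `𝟙`). [cite: Balaban1985BackgroundPropagators, Cor. 3.5 p.407 (U = 1 is [4]); Balaban1984PropagatorsII, (2.67) p.234] -/
theorem holderSiteTY_eq_hqTP_of_trivial (parS : SiteParY 𝔸 i) (U : CfgY 𝔸 i) (hU : parS U = fun _ _ => 1) (ε : ℝ) (f : SiteY i → ℝ) :
    holderSiteTY i parS U ε f = hqTP (toKT i) ε f := by
  haveI : Nonempty (BallY 𝔸) := ballY_nonempty
  refine le_antisymm (ciSup_le fun E => ?_) (hqTP_le_holderSiteTY i parS U ε f)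
  rw [hU]
  exact hqS_one_liftY_le i ε f E

/-- with trivial transport every ball direction's bond quotient sup is below r03's flat functional.
[cite: Balaban1985BackgroundPropagators, Cor. 3.5 p.407 (U = 1 is [4]); Balaban1984PropagatorsII, (2.137) p.247] -/
theorem hqAB_one_liftY_le (ε : ℝ) (J : FBondY i → ℝ) (E : BallY 𝔸) :
    hqAB i (fun _ _ => 1) ε (liftY J (E : 𝔸)) ≤ (kGeoG i).holder ε J := by
  rw [← hqAB_liftY_one (𝔸 := 𝔸) i (fun _ _ => 1) ε J]
  unfold hqAB
  refine iSup_ite_le_iSup_ite (X := FBondY i × FBondY i) _ _ _ (fun q _ => ?_)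
    (fun q => mul_nonneg (Real.rpow_nonneg (tpar_nonneg i _ _) _) (norm_nonneg _))
  refine mul_le_mul_of_nonneg_left ?_ (Real.rpow_nonneg (tpar_nonneg i _ _) _)
  rw [R_one, R_one, norm_liftY_one_sub, liftY_sub_apply]
  exact norm_real_smul_ball_le _ E

/-- ★ **THE TRIVIAL-TRANSPORT FACE, bonds**: if `parB U` is trivial then `‖J‖^{U}_ε = kGeoG.holder ε J`. [cite: Balaban1985BackgroundPropagators, Cor. 3.5 p.407; Balaban1984PropagatorsII, (2.137) p.247] -/
theorem holderBondTY_eq_kGeoG_holder_of_trivial (parB : BondParY 𝔸 i) (U : CfgY 𝔸 i) (hU : parB U = fun _ _ => 1) (ε : ℝ)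
    (J : FBondY i → ℝ) : holderBondTY i parB U ε J = (kGeoG i).holder ε J := by
  haveI : Nonempty (BallY 𝔸) := ballY_nonempty
  refine le_antisymm (ciSup_le fun E => ?_) (kGeoG_holder_le_holderBondTY i parB U ε J)
  rw [hU]
  exact hqAB_one_liftY_le i ε J E

/-- ★★ **THE TRIVIAL-TRANSPORT FACE**: where both transporters are trivial, NODE 00's transported data norm IS the v4 field `(geo9K i).holder` — there
the companion's T-frames are the v4 frames (`B9Ineq343to345T.…_const_iff`). [cite: Balaban1985BackgroundPropagators, Cor. 3.5 p.407 (U = 1 is [4]), (3.40) p.397] -/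
theorem holderTY_eq_geo9K_holder_of_trivial (parS : SiteParY 𝔸 i) (parB : BondParY 𝔸 i) (U : CfgY 𝔸 i) (hS : parS U = fun _ _ => 1)
    (hB : parB U = fun _ _ => 1) (ε : ℝ) (lam : KLoc i) : holderTY i parS parB U ε lam = (geo9K i).holder ε lam := by
  cases lam with
  | inl f => exact holderSiteTY_eq_hqTP_of_trivial i parS U hS ε f
  | inr J => exact holderBondTY_eq_kGeoG_holder_of_trivial i parB U hB ε J

/-- ★★ **AT THE LETTERS OF RECORD, `U = 1`**: `holderTYR i 1 ε λ = (geo9K i).holder ε λ` — Cor. 3.5's configuration: NODE 00's transported data norm is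
the v4 field. [cite: Balaban1985BackgroundPropagators, Cor. 3.5 p.407 (U = 1 is [4]), (3.40) p.397] -/
theorem holderTYR_one (ε : ℝ) (lam : KLoc i) : holderTYR (𝔸 := 𝔸) i (fun _ _ => 1) ε lam = (geo9K i).holder ε lam :=
  holderTY_eq_geo9K_holder_of_trivial i (parSymY i) (parBY i) (fun _ _ => 1) (parSymY_one_eq i) (parBY_one_eq i) ε lam

end Domination

/-! ## §4 The transfer in the data functional (generic over the companion's carriers) -/

section Transfer

variable {g : Geometry} {B : Backgrounds}

/-- ★ **MONOTONICITY OF THE HÖLDER BLOCK IN THE DATA FUNCTIONAL**: if the (3.43)–(3.45) conjuncts hold at `U` with a data functional `h₁ ≥ 0` and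
`h₁ ≤ h₂` pointwise, they hold with `h₂` and the constants `B ↦ max B 0` (the (3.43) conjunct is unchanged).  Sign facts on the carrier
(`0 ≤ len, cutH, supNorm`) are hypotheses. [cite: Balaban1985BackgroundPropagators, (3.43)–(3.45) p.398, bookkeeping] -/
theorem ineq343_345T_mono {K : KernelFamily g B} {h₁ h₂ : B.Cfg → ℝ → g.Loc → ℝ} {Bβ Bε : ℝ → ℝ} {Bεβ : ℝ → ℝ → ℝ} {δ₀ : ℝ} {U : B.Cfg}
    (hlen : ∀ y, 0 ≤ g.len y) (hcut : ∀ β ζ, 0 ≤ g.cutH β ζ) (hsup : ∀ lam, 0 ≤ g.supNorm lam)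
    (h₁0 : ∀ ε lam, 0 ≤ h₁ U ε lam) (hle : ∀ ε lam, h₁ U ε lam ≤ h₂ U ε lam) (h : Ineq343_345T K h₁ Bβ Bε Bεβ δ₀ U) :
    Ineq343_345T K h₂ Bβ (fun ε => max (Bε ε) 0) (fun ε β => max (Bεβ ε β) 0) δ₀ U := by
  obtain ⟨h43, h44, h45⟩ := h
  refine ⟨h43, fun ε lam y y' hε hε1 hs => ?_, fun ε β lam ζ y y' hε hε1 hβ hβ1 hc hs => ?_⟩
  · have hX : 0 ≤ Real.exp (-(δ₀ * g.dist y y')) * (h₁ U ε lam + g.supNorm lam) :=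
      mul_nonneg (Real.exp_nonneg _) (add_nonneg (h₁0 ε lam) (hsup lam))
    calc K.e4 U lam y ≤ Bε ε * Real.exp (-(δ₀ * g.dist y y')) * (h₁ U ε lam + g.supNorm lam) := h44 ε lam y y' hε hε1 hs
      _ = Bε ε * (Real.exp (-(δ₀ * g.dist y y')) * (h₁ U ε lam + g.supNorm lam)) := by ring
      _ ≤ max (Bε ε) 0 * (Real.exp (-(δ₀ * g.dist y y')) * (h₁ U ε lam + g.supNorm lam)) :=
          mul_le_mul_of_nonneg_right (le_max_left _ _) hX
      _ ≤ max (Bε ε) 0 * (Real.exp (-(δ₀ * g.dist y y')) * (h₂ U ε lam + g.supNorm lam)) :=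
          mul_le_mul_of_nonneg_left (mul_le_mul_of_nonneg_left (add_le_add (hle ε lam) le_rfl) (Real.exp_nonneg _)) (le_max_right _ _)
      _ = max (Bε ε) 0 * Real.exp (-(δ₀ * g.dist y y')) * (h₂ U ε lam + g.supNorm lam) := by ring
  · have hW : 0 ≤ (g.len y) ^ (-β) * g.cutH β ζ * Real.exp (-(δ₀ * g.dist y y')) :=
      mul_nonneg (mul_nonneg (Real.rpow_nonneg (hlen y) _) (hcut β ζ)) (Real.exp_nonneg _)
    have hD : 0 ≤ h₁ U (β + ε) lam + g.supNorm lam := add_nonneg (h₁0 _ lam) (hsup lam)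
    calc K.h2 U lam β ζ
        ≤ Bεβ ε β * (g.len y) ^ (-β) * g.cutH β ζ * Real.exp (-(δ₀ * g.dist y y')) * (h₁ U (β + ε) lam + g.supNorm lam) :=
          h45 ε β lam ζ y y' hε hε1 hβ hβ1 hc hs
      _ = Bεβ ε β * ((g.len y) ^ (-β) * g.cutH β ζ * Real.exp (-(δ₀ * g.dist y y')) * (h₁ U (β + ε) lam + g.supNorm lam)) := by ring
      _ ≤ max (Bεβ ε β) 0 * ((g.len y) ^ (-β) * g.cutH β ζ * Real.exp (-(δ₀ * g.dist y y')) * (h₁ U (β + ε) lam + g.supNorm lam)) :=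
          mul_le_mul_of_nonneg_right (le_max_left _ _) (mul_nonneg hW hD)
      _ ≤ max (Bεβ ε β) 0 * ((g.len y) ^ (-β) * g.cutH β ζ * Real.exp (-(δ₀ * g.dist y y')) * (h₂ U (β + ε) lam + g.supNorm lam)) :=
          mul_le_mul_of_nonneg_left (mul_le_mul_of_nonneg_left (add_le_add (hle _ lam) le_rfl) hW) (le_max_right _ _)
      _ = max (Bεβ ε β) 0 * (g.len y) ^ (-β) * g.cutH β ζ * Real.exp (-(δ₀ * g.dist y y')) * (h₂ U (β + ε) lam + g.supNorm lam) := by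
          ring

variable {I : Type} {c35 : ℝ} {geo : I → Geometry} {bg : I → Backgrounds}

/-- **Theorem 3.1's T-frame is monotone in the data functional** (same `M₁, δ₀, a₀, B₀, B₀(β)`; `B′₀(ε) ↦ max B′₀(ε) 0`, `B′₀(ε,β) ↦ max B′₀(ε,β) 0`).
[cite: Balaban1985BackgroundPropagators, Thm 3.1 (3.42)–(3.47) pp.397–398, bookkeeping] -/
theorem thm31PrintedT_mono {Gp : ∀ j, KernelFamily (geo j) (bg j)} {h₁ h₂ : ∀ j, (bg j).Cfg → ℝ → (geo j).Loc → ℝ}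
    (hlen : ∀ j y, 0 ≤ (geo j).len y) (hcut : ∀ j β ζ, 0 ≤ (geo j).cutH β ζ) (hsup : ∀ j lam, 0 ≤ (geo j).supNorm lam)
    (h₁0 : ∀ j U ε lam, 0 ≤ h₁ j U ε lam) (hle : ∀ j U ε lam, h₁ j U ε lam ≤ h₂ j U ε lam) (h : Thm31PrintedT c35 geo bg Gp h₁) :
    Thm31PrintedT c35 geo bg Gp h₂ := by
  obtain ⟨M₁, δ₀, a₀, B₀, Bβ, Bε, Bεβ, hM₁, hδ₀, ha₀, hB₀, hall⟩ := h
  refine ⟨M₁, δ₀, a₀, B₀, Bβ, fun ε => max (Bε ε) 0, fun ε β => max (Bεβ ε β) 0, hM₁, hδ₀, ha₀, hB₀,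
    fun j hM α₀ hα₀ hMa U hU => ?_⟩
  obtain ⟨h342, h343⟩ := hall j hM α₀ hα₀ hMa U hU
  exact ⟨h342, ineq343_345T_mono (hlen j) (hcut j) (hsup j) (h₁0 j U) (hle j U) h343⟩

/-- **Theorem 3.3's T-frame is monotone in the data functional.** [cite: Balaban1985BackgroundPropagators, Thm 3.3 p.399, bookkeeping] -/
theorem thm33PrintedT_mono {Gp GA : ∀ j, KernelFamily (geo j) (bg j)} {h₁ h₂ : ∀ j, (bg j).Cfg → ℝ → (geo j).Loc → ℝ}
    (hlen : ∀ j y, 0 ≤ (geo j).len y) (hcut : ∀ j β ζ, 0 ≤ (geo j).cutH β ζ) (hsup : ∀ j lam, 0 ≤ (geo j).supNorm lam)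
    (h₁0 : ∀ j U ε lam, 0 ≤ h₁ j U ε lam) (hle : ∀ j U ε lam, h₁ j U ε lam ≤ h₂ j U ε lam) (h : Thm33PrintedT c35 geo bg Gp GA h₁) :
    Thm33PrintedT c35 geo bg Gp GA h₂ := by
  obtain ⟨M₁, δ₀, a₀, B₀, Bβ, Bε, Bεβ, hM₁, hδ₀, ha₀, hB₀, hall⟩ := h
  refine ⟨M₁, δ₀, a₀, B₀, Bβ, fun ε => max (Bε ε) 0, fun ε β => max (Bεβ ε β) 0, hM₁, hδ₀, ha₀, hB₀,
    fun j hM α₀ hα₀ hMa U hU => ?_⟩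
  obtain ⟨⟨hp342, hp343⟩, hA342, hA343⟩ := hall j hM α₀ hα₀ hMa U hU
  exact ⟨⟨hp342, ineq343_345T_mono (hlen j) (hcut j) (hsup j) (h₁0 j U) (hle j U) hp343⟩,
    hA342, ineq343_345T_mono (hlen j) (hcut j) (hsup j) (h₁0 j U) (hle j U) hA343⟩

/-- **Theorem 3.4's T-frame is monotone in the data functional** (the Hölder blocks at the extended configuration `U′U`; `a₁` unchanged).
[cite: Balaban1985BackgroundPropagators, Thm 3.4 p.400, bookkeeping] -/
theorem thm34PrintedT_mono {Gp GA : ∀ j, KernelFamily (geo j) (bg j)} {IsAnalyticExt : ∀ j, KernelFamily (geo j) (bg j) → (bg j).Cfg → ℝ → Prop}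
    {h₁ h₂ : ∀ j, (bg j).Cfg → ℝ → (geo j).Loc → ℝ}
    (hlen : ∀ j y, 0 ≤ (geo j).len y) (hcut : ∀ j β ζ, 0 ≤ (geo j).cutH β ζ) (hsup : ∀ j lam, 0 ≤ (geo j).supNorm lam)
    (h₁0 : ∀ j U ε lam, 0 ≤ h₁ j U ε lam) (hle : ∀ j U ε lam, h₁ j U ε lam ≤ h₂ j U ε lam)
    (h : Thm34PrintedT c35 geo bg Gp GA IsAnalyticExt h₁) : Thm34PrintedT c35 geo bg Gp GA IsAnalyticExt h₂ := by
  obtain ⟨a₁, M₁, δ₀, a₀, B₀, Bβ, Bε, Bεβ, ha₁, hM₁, hδ₀, ha₀, hB₀, hall⟩ := h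
  refine ⟨a₁, M₁, δ₀, a₀, B₀, Bβ, fun ε => max (Bε ε) 0, fun ε β => max (Bεβ ε β) 0, ha₁, hM₁, hδ₀, ha₀, hB₀,
    fun j hM α₀ α₁ hα₀ hMa hα₁ hα₁a U hU => ?_⟩
  obtain ⟨hanp, hanA, hext⟩ := hall j hM α₀ α₁ hα₀ hMa hα₁ hα₁a U hU
  refine ⟨hanp, hanA, fun U' hU' => ?_⟩
  obtain ⟨hp342, hp343, hA342, hA343⟩ := hext U' hU'
  exact ⟨hp342, ineq343_345T_mono (hlen j) (hcut j) (hsup j) (h₁0 j _) (hle j _) hp343, hA342,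
    ineq343_345T_mono (hlen j) (hcut j) (hsup j) (h₁0 j _) (hle j _) hA343⟩

/-- ★ **v4 FRAME + DOMINATION ⇒ T-FRAME (Theorem 3.1)**: a transported data-norm family that dominates the carrier field `(geo j).holder`
pointwise turns the v4 frame into the companion's T-frame. [cite: Balaban1985BackgroundPropagators, Thm 3.1 pp.397–398, (3.40) p.397, bookkeeping] -/
theorem thm31PrintedT_of_printed {Gp : ∀ j, KernelFamily (geo j) (bg j)} (hT : ∀ j, (bg j).Cfg → ℝ → (geo j).Loc → ℝ)
    (hlen : ∀ j y, 0 ≤ (geo j).len y) (hcut : ∀ j β ζ, 0 ≤ (geo j).cutH β ζ) (hsup : ∀ j lam, 0 ≤ (geo j).supNorm lam)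
    (hhol : ∀ j ε lam, 0 ≤ (geo j).holder ε lam) (hdom : ∀ j U ε lam, (geo j).holder ε lam ≤ hT j U ε lam)
    (h : Thm31Printed c35 geo bg Gp) : Thm31PrintedT c35 geo bg Gp hT :=
  thm31PrintedT_mono (h₁ := fun j _ => (geo j).holder) hlen hcut hsup (fun j _ => hhol j) hdom
    ((thm31PrintedT_const_iff c35 geo bg Gp).2 h)

/-- ★ **v4 FRAME + DOMINATION ⇒ T-FRAME (Theorem 3.3).** [cite: Balaban1985BackgroundPropagators, Thm 3.3 p.399, (3.40) p.397, bookkeeping] -/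
theorem thm33PrintedT_of_printed {Gp GA : ∀ j, KernelFamily (geo j) (bg j)} (hT : ∀ j, (bg j).Cfg → ℝ → (geo j).Loc → ℝ)
    (hlen : ∀ j y, 0 ≤ (geo j).len y) (hcut : ∀ j β ζ, 0 ≤ (geo j).cutH β ζ) (hsup : ∀ j lam, 0 ≤ (geo j).supNorm lam)
    (hhol : ∀ j ε lam, 0 ≤ (geo j).holder ε lam) (hdom : ∀ j U ε lam, (geo j).holder ε lam ≤ hT j U ε lam)
    (h : Thm33Printed c35 geo bg Gp GA) : Thm33PrintedT c35 geo bg Gp GA hT :=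
  thm33PrintedT_mono (h₁ := fun j _ => (geo j).holder) hlen hcut hsup (fun j _ => hhol j) hdom
    ((thm33PrintedT_const_iff c35 geo bg Gp GA).2 h)

/-- ★ **v4 FRAME + DOMINATION ⇒ T-FRAME (Theorem 3.4).** [cite: Balaban1985BackgroundPropagators, Thm 3.4 p.400, (3.40) p.397, bookkeeping] -/
theorem thm34PrintedT_of_printed {Gp GA : ∀ j, KernelFamily (geo j) (bg j)}
    {IsAnalyticExt : ∀ j, KernelFamily (geo j) (bg j) → (bg j).Cfg → ℝ → Prop} (hT : ∀ j, (bg j).Cfg → ℝ → (geo j).Loc → ℝ)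
    (hlen : ∀ j y, 0 ≤ (geo j).len y) (hcut : ∀ j β ζ, 0 ≤ (geo j).cutH β ζ) (hsup : ∀ j lam, 0 ≤ (geo j).supNorm lam)
    (hhol : ∀ j ε lam, 0 ≤ (geo j).holder ε lam) (hdom : ∀ j U ε lam, (geo j).holder ε lam ≤ hT j U ε lam)
    (h : Thm34Printed c35 geo bg Gp GA IsAnalyticExt) : Thm34PrintedT c35 geo bg Gp GA IsAnalyticExt hT :=
  thm34PrintedT_mono (h₁ := fun j _ => (geo j).holder) hlen hcut hsup (fun j _ => hhol j) hdom
    ((thm34PrintedT_const_iff c35 geo bg Gp GA IsAnalyticExt).2 h)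

end Transfer

/-! ## §5 At NODE 00's carriers: the v4 frames yield the T-frames with the transported data norm -/

section AtNode00

variable {i}
variable [NormOneClass 𝔸]

/-- `0 ≤ (geo9K i).len y` (r03's `len_pos`). [cite: Balaban1984PropagatorsII, (2.1) p.224, bookkeeping] -/
theorem geo9K_len_nonneg (y : (geo9K i).Site) : 0 ≤ (geo9K i).len y := (B6KLevelCensusIndexV1.len_pos i y).le

variable {I : Type} (g : I → KIdx d ℓ hd hL b₀ b₁) {c35 : ℝ} {bg : I → Backgrounds}

/-- ★★★ **THEOREM 3.1 AT NODE 00's CARRIERS, T-FORM FROM v4**: for every `KIdx`-indexed carriers family `geo9K ∘ g`, every backgrounds family, every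
decoding `cfgOf` of its configurations into NODE 00's configurations and every pair of transporter letters, the v4 frame implies the companion's
T-frame with NODE 00's transported Hölder data norm. [cite: Balaban1985BackgroundPropagators, Thm 3.1 pp.397–398, (3.40) p.397, (3.44)–(3.45) p.398] -/
theorem thm31PrintedT_holderTY_of_printed {Gp : ∀ j, KernelFamily (geo9K (g j)) (bg j)} (parS : ∀ j, SiteParY 𝔸 (g j))
    (parB : ∀ j, BondParY 𝔸 (g j)) (cfgOf : ∀ j, (bg j).Cfg → CfgY 𝔸 (g j)) (h : Thm31Printed c35 (fun j => geo9K (g j)) bg Gp) :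
    Thm31PrintedT c35 (fun j => geo9K (g j)) bg Gp (fun j W => holderTY (g j) (parS j) (parB j) (cfgOf j W)) :=
  thm31PrintedT_of_printed _ (fun _ => geo9K_len_nonneg) (fun j => geo9K_cutH_nonneg (g j)) (fun j => geo9K_supNorm_nonneg (g j))
    (fun j => geo9K_holder_nonneg (g j)) (fun j W ε lam => geo9K_holder_le_holderTY (g j) (parS j) (parB j) (cfgOf j W) ε lam) h

/-- ★★★ **THEOREM 3.3 AT NODE 00's CARRIERS, T-FORM FROM v4.** [cite: Balaban1985BackgroundPropagators, Thm 3.3 p.399, (3.40) p.397] -/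
theorem thm33PrintedT_holderTY_of_printed {Gp GA : ∀ j, KernelFamily (geo9K (g j)) (bg j)} (parS : ∀ j, SiteParY 𝔸 (g j))
    (parB : ∀ j, BondParY 𝔸 (g j)) (cfgOf : ∀ j, (bg j).Cfg → CfgY 𝔸 (g j)) (h : Thm33Printed c35 (fun j => geo9K (g j)) bg Gp GA) :
    Thm33PrintedT c35 (fun j => geo9K (g j)) bg Gp GA (fun j W => holderTY (g j) (parS j) (parB j) (cfgOf j W)) :=
  thm33PrintedT_of_printed _ (fun _ => geo9K_len_nonneg) (fun j => geo9K_cutH_nonneg (g j)) (fun j => geo9K_supNorm_nonneg (g j))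
    (fun j => geo9K_holder_nonneg (g j)) (fun j W ε lam => geo9K_holder_le_holderTY (g j) (parS j) (parB j) (cfgOf j W) ε lam) h

/-- ★★★ **THEOREM 3.4 AT NODE 00's CARRIERS, T-FORM FROM v4** (at a product `U′U` the decoding `cfgOf` presents the BASE `U` — print bounds `G′(U′U)` in
the norms OF `U`). [cite: Balaban1985BackgroundPropagators, Thm 3.4 p.400, p.403 l.1–9, (3.40) p.397] -/
theorem thm34PrintedT_holderTY_of_printed {Gp GA : ∀ j, KernelFamily (geo9K (g j)) (bg j)}
    {IsAnalyticExt : ∀ j, KernelFamily (geo9K (g j)) (bg j) → (bg j).Cfg → ℝ → Prop} (parS : ∀ j, SiteParY 𝔸 (g j))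
    (parB : ∀ j, BondParY 𝔸 (g j)) (cfgOf : ∀ j, (bg j).Cfg → CfgY 𝔸 (g j)) (h : Thm34Printed c35 (fun j => geo9K (g j)) bg Gp GA IsAnalyticExt) :
    Thm34PrintedT c35 (fun j => geo9K (g j)) bg Gp GA IsAnalyticExt (fun j W => holderTY (g j) (parS j) (parB j) (cfgOf j W)) :=
  thm34PrintedT_of_printed _ (fun _ => geo9K_len_nonneg) (fun j => geo9K_cutH_nonneg (g j)) (fun j => geo9K_supNorm_nonneg (g j))
    (fun j => geo9K_holder_nonneg (g j)) (fun j W ε lam => geo9K_holder_le_holderTY (g j) (parS j) (parB j) (cfgOf j W) ε lam) h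

variable (f : I → MemberY d ℓ hd hL b₀ b₁ Mstar)

/-- ★★★ **AT MEMBER-INDEXED CARRIERS `geo9Y ∘ f` WITH THE LETTERS OF RECORD** (Theorem 3.1): v4 ⇒ T with `holderTYR`.
[cite: Balaban1985BackgroundPropagators, Thm 3.1 pp.397–398, (3.40) p.397] -/
theorem thm31PrintedT_holderTYR_of_printed {Gp : ∀ j, KernelFamily (geo9Y (f j)) (bg j)} (cfgOf : ∀ j, (bg j).Cfg → CfgY 𝔸 (f j).toKIdx)
    (h : Thm31Printed c35 (fun j => geo9Y (f j)) bg Gp) :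
    Thm31PrintedT c35 (fun j => geo9Y (f j)) bg Gp (fun j W => holderTYR (f j).toKIdx (cfgOf j W)) :=
  thm31PrintedT_holderTY_of_printed (fun j => (f j).toKIdx) (fun j => parSymY (f j).toKIdx) (fun j => parBY (f j).toKIdx) cfgOf h

/-- ★★★ (Theorem 3.3) at member-indexed carriers with the letters of record. [cite: Balaban1985BackgroundPropagators, Thm 3.3 p.399, (3.40) p.397] -/
theorem thm33PrintedT_holderTYR_of_printed {Gp GA : ∀ j, KernelFamily (geo9Y (f j)) (bg j)} (cfgOf : ∀ j, (bg j).Cfg → CfgY 𝔸 (f j).toKIdx)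
    (h : Thm33Printed c35 (fun j => geo9Y (f j)) bg Gp GA) :
    Thm33PrintedT c35 (fun j => geo9Y (f j)) bg Gp GA (fun j W => holderTYR (f j).toKIdx (cfgOf j W)) :=
  thm33PrintedT_holderTY_of_printed (fun j => (f j).toKIdx) (fun j => parSymY (f j).toKIdx) (fun j => parBY (f j).toKIdx) cfgOf h

/-- ★★★ (Theorem 3.4) at member-indexed carriers with the letters of record. [cite: Balaban1985BackgroundPropagators, Thm 3.4 p.400, (3.40) p.397] -/
theorem thm34PrintedT_holderTYR_of_printed {Gp GA : ∀ j, KernelFamily (geo9Y (f j)) (bg j)}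
    {IsAnalyticExt : ∀ j, KernelFamily (geo9Y (f j)) (bg j) → (bg j).Cfg → ℝ → Prop} (cfgOf : ∀ j, (bg j).Cfg → CfgY 𝔸 (f j).toKIdx)
    (h : Thm34Printed c35 (fun j => geo9Y (f j)) bg Gp GA IsAnalyticExt) :
    Thm34PrintedT c35 (fun j => geo9Y (f j)) bg Gp GA IsAnalyticExt (fun j W => holderTYR (f j).toKIdx (cfgOf j W)) :=
  thm34PrintedT_holderTY_of_printed (fun j => (f j).toKIdx) (fun j => parSymY (f j).toKIdx) (fun j => parBY (f j).toKIdx) cfgOf h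

end AtNode00

/-! ## §6 At the [B9] carrier bundle over the CODED carrier (the N06 certificate's conclusion object): the leaf's v4 frames yield the T-frames -/

section Leaf

open DagBinding (B9Leaf B9LeafX)
open B9SectBCodedClassR (RegExtraY extraYPb)
open B9SectBGpReadingsY (baseY)
open B9PinCarriersKLevelV1 (OperatorLayerY)
open B9PinGeometryKLevelV1 (c35Y)
open B9Eq360DeltaPrimeAY (AfldY)
open B9SectBCodedCarrier (CCfg)

variable {i}

/-- ★★ **THE TRANSPORTED DATA NORM OVER THE CODED CARRIER**: at a coded configuration (a base `U`, a multiplier code, or a product `U′U` remembered as a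
pair) the data norm of record OF ITS BASE `U` — print's Theorem 3.4 bounds the extended operators `G′(U′U)`, `G(U′U)` in the norms (3.39)–(3.40) OF `U`
(R13-U1; dag-n06-c's base reading `B9SectBGpReadingsY.baseY`: `base U ↦ U`, `prod U a ↦ U`, a bare multiplier code `mult a ↦ e^{iηa}` — never a
configuration under the classes).
[cite: Balaban1985BackgroundPropagators, Thm 3.4 p.400, p.403 l.1–9, (3.40) p.397] -/
def holderTYC (i : KIdx d ℓ hd hL b₀ b₁) : CCfg (CfgY 𝔸 i) (AfldY 𝔸 i) → ℝ → KLoc i → ℝ := fun W => holderTYR i (baseY i W)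

/-- at a base configuration. [cite: Balaban1985BackgroundPropagators, (3.40) p.397, bookkeeping] -/
@[simp] theorem holderTYC_base (U : CfgY 𝔸 i) : holderTYC i (.base U) = holderTYR i U := rfl

/-- at a product `U′U` (coded `prod U a`): the norm OF THE BASE `U`. [cite: Balaban1985BackgroundPropagators, Thm 3.4 p.400, p.403 l.1–9, bookkeeping] -/
@[simp] theorem holderTYC_prod (U : CfgY 𝔸 i) (a : AfldY 𝔸 i) : holderTYC i (.prod U a) = holderTYR i U := rfl

variable [NormOneClass 𝔸] (P : RegExtraY d ℓ hd hL b₀ b₁ Mstar 𝔸) (G : Subgroup 𝔸ˣ) {J : Type} (f : J → MemberY d ℓ hd hL b₀ b₁ Mstar)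
  {ι : Type} [Fintype ι] (b : Module.Basis ι ℝ 𝔸) (ιB : ∀ j : J, BlkY (f j).toKIdx → IBondY (f j).toKIdx)
  (C38 : ∀ j : J, ℝ → CfgY 𝔸 (f j).toKIdx → AfldY 𝔸 (f j).toKIdx → Prop) (ops : ∀ x : MemberY d ℓ hd hL b₀ b₁ Mstar, OperatorLayerY d ℓ hd hL b₀ b₁ Mstar 𝔸 G x)

/-- ★★★ **THE B9 LEAF OVER THE CODED CARRIER BUNDLE `carriersYU` YIELDS THEOREM 3.1 IN T-FORM WITH NODE 00's TRANSPORTED DATA NORM** `holderTYC` (the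
letters of record; the data norm of the base configuration).  The carriers are written as the bundle's field VALUES (`carriersYU_c35 ∕ _geo9 ∕ _bg9`, all
`rfl`), at which the leaf's `t31` is literally the v4 frame. [cite: Balaban1985BackgroundPropagators, Thm 3.1 pp.397–398, (3.40) p.397, (3.44)–(3.45) p.398] -/
theorem thm31T_holderTYC_of_b9Leaf_carriersYU (h : B9Leaf (carriersYU P G f b ιB C38 ops).toPrintedCarriers9) :
    Thm31PrintedT c35Y (fun j => geo9Y (f j)) (fun j => (codingYU P G f ιB C38 j).bg) (fun j => (carriersYU P G f b ιB C38 ops).Gp j)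
      (fun j => holderTYC (f j).toKIdx) :=
  thm31PrintedT_holderTYR_of_printed (bg := fun j => (codingYU P G f ιB C38 j).bg) (Gp := fun j => (carriersYU P G f b ιB C38 ops).Gp j) f
    (fun j W => baseY (f j).toKIdx W) h.t31

/-- ★★★ **… THEOREM 3.3 IN T-FORM** (both pairs `G′`, `G`). [cite: Balaban1985BackgroundPropagators, Thm 3.3 p.399, (3.40) p.397] -/
theorem thm33T_holderTYC_of_b9Leaf_carriersYU (h : B9Leaf (carriersYU P G f b ιB C38 ops).toPrintedCarriers9) :
    Thm33PrintedT c35Y (fun j => geo9Y (f j)) (fun j => (codingYU P G f ιB C38 j).bg) (fun j => (carriersYU P G f b ιB C38 ops).Gp j)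
      (fun j => (carriersYU P G f b ιB C38 ops).GA j) (fun j => holderTYC (f j).toKIdx) :=
  thm33PrintedT_holderTYR_of_printed (bg := fun j => (codingYU P G f ιB C38 j).bg) (Gp := fun j => (carriersYU P G f b ιB C38 ops).Gp j)
    (GA := fun j => (carriersYU P G f b ιB C38 ops).GA j) f (fun j W => baseY (f j).toKIdx W) h.t33

/-- ★★★ **… THEOREM 3.4 IN T-FORM** (the Hölder blocks at the coded product `U′U`, read in the norms of the base `U`).
[cite: Balaban1985BackgroundPropagators, Thm 3.4 p.400, p.403 l.1–9, (3.40) p.397] -/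
theorem thm34T_holderTYC_of_b9Leaf_carriersYU (h : B9Leaf (carriersYU P G f b ιB C38 ops).toPrintedCarriers9) :
    Thm34PrintedT c35Y (fun j => geo9Y (f j)) (fun j => (codingYU P G f ιB C38 j).bg) (fun j => (carriersYU P G f b ιB C38 ops).Gp j)
      (fun j => (carriersYU P G f b ιB C38 ops).GA j) (fun j => (carriersYU P G f b ιB C38 ops).IsAnalyticExt j) (fun j => holderTYC (f j).toKIdx) :=
  thm34PrintedT_holderTYR_of_printed (bg := fun j => (codingYU P G f ιB C38 j).bg) (Gp := fun j => (carriersYU P G f b ιB C38 ops).Gp j)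
    (GA := fun j => (carriersYU P G f b ιB C38 ops).GA j) (IsAnalyticExt := fun j => (carriersYU P G f b ιB C38 ops).IsAnalyticExt j) f
    (fun j W => baseY (f j).toKIdx W) h.t34

/-- ★★★ the three T-forms from the EXTENDED leaf `B9LeafX` (what the N06 certificate editions conclude), through `.numbered`.
[cite: Balaban1985BackgroundPropagators, Thms 3.1–3.4 pp.397–400, (3.40) p.397] -/
theorem thmsT_holderTYC_of_b9LeafX_carriersYU (h : B9LeafX (carriersYU P G f b ιB C38 ops)) :
    Thm31PrintedT c35Y (fun j => geo9Y (f j)) (fun j => (codingYU P G f ιB C38 j).bg) (fun j => (carriersYU P G f b ιB C38 ops).Gp j)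
        (fun j => holderTYC (f j).toKIdx) ∧
      Thm33PrintedT c35Y (fun j => geo9Y (f j)) (fun j => (codingYU P G f ιB C38 j).bg) (fun j => (carriersYU P G f b ιB C38 ops).Gp j)
        (fun j => (carriersYU P G f b ιB C38 ops).GA j) (fun j => holderTYC (f j).toKIdx) ∧
      Thm34PrintedT c35Y (fun j => geo9Y (f j)) (fun j => (codingYU P G f ιB C38 j).bg) (fun j => (carriersYU P G f b ιB C38 ops).Gp j)
        (fun j => (carriersYU P G f b ιB C38 ops).GA j) (fun j => (carriersYU P G f b ιB C38 ops).IsAnalyticExt j)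
        (fun j => holderTYC (f j).toKIdx) :=
  ⟨thm31T_holderTYC_of_b9Leaf_carriersYU P G f b ιB C38 ops h.numbered, thm33T_holderTYC_of_b9Leaf_carriersYU P G f b ιB C38 ops h.numbered,
    thm34T_holderTYC_of_b9Leaf_carriersYU P G f b ιB C38 ops h.numbered⟩

end Leaf

section Record

open DagBinding (B9LeafX)
open B9SectBCodedClassR (extraYPb)
open B9PinGeometryKLevelV1 (c35Y)
open B9Eq360DeltaPrimeAY (AfldY)
open B7Prop2SpecialUnitary (specialUnitaryUnits)
open scoped Matrix.Norms.L2Operator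

variable {N : ℕ} [NormOneClass (Matrix (Fin N) (Fin N) ℂ)] (θ : Stage3Params) (Mstar : ℕ) (ops : OpsY N θ Mstar) {J : Type}
  (f : J → MemberY θ.d₆ θ.ℓ₆ θ.hd' θ.hL' θ.b₀ θ.b₁ Mstar) {ι : Type} [Fintype ι] (b : Module.Basis ι ℝ (Matrix (Fin N) (Fin N) ℂ))
  (ιB : ∀ j : J, BlkY (f j).toKIdx → IBondY (f j).toKIdx)
  (C38 : ∀ j : J, ℝ → CfgY (Matrix (Fin N) (Fin N) ℂ) (f j).toKIdx → AfldY (Matrix (Fin N) (Fin N) ℂ) (f j).toKIdx → Prop)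

/-- ★★★ **AT THE RECORD** (`M_N(ℂ)` with `‖𝟙‖ = 1`, `SU(N)`, the record's reading `extraYPb` of print's class — the N06 certificate's conclusion object
`Y9OfRecordUPb N θ Mstar ops f b ιB C38`, whose carriers ARE the field values below, `Y9OfRecordUPb_eq_carriersYU` + `carriersYU_*`, all `rfl`):
the extended leaf yields Theorems 3.1 ∕ 3.3 ∕ 3.4 in T-form with NODE 00's transported Hölder data norm of record.
[cite: Balaban1985BackgroundPropagators, Thms 3.1–3.4 pp.397–400, (3.40) p.397, (3.44)–(3.45) p.398] -/
theorem thmsT_holderTYC_of_b9LeafX_record (h : B9LeafX (Y9OfRecordUPb N θ Mstar ops f b ιB C38)) :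
    Thm31PrintedT c35Y (fun j => geo9Y (f j))
        (fun j => (codingYU (extraYPb (Matrix (Fin N) (Fin N) ℂ) (specialUnitaryUnits (Fin N))) (specialUnitaryUnits (Fin N)) f ιB C38 j).bg)
        (fun j => (Y9OfRecordUPb N θ Mstar ops f b ιB C38).Gp j) (fun j => holderTYC (f j).toKIdx) ∧
      Thm33PrintedT c35Y (fun j => geo9Y (f j))
        (fun j => (codingYU (extraYPb (Matrix (Fin N) (Fin N) ℂ) (specialUnitaryUnits (Fin N))) (specialUnitaryUnits (Fin N)) f ιB C38 j).bg)
        (fun j => (Y9OfRecordUPb N θ Mstar ops f b ιB C38).Gp j) (fun j => (Y9OfRecordUPb N θ Mstar ops f b ιB C38).GA j)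
        (fun j => holderTYC (f j).toKIdx) ∧
      Thm34PrintedT c35Y (fun j => geo9Y (f j))
        (fun j => (codingYU (extraYPb (Matrix (Fin N) (Fin N) ℂ) (specialUnitaryUnits (Fin N))) (specialUnitaryUnits (Fin N)) f ιB C38 j).bg)
        (fun j => (Y9OfRecordUPb N θ Mstar ops f b ιB C38).Gp j) (fun j => (Y9OfRecordUPb N θ Mstar ops f b ιB C38).GA j)
        (fun j => (Y9OfRecordUPb N θ Mstar ops f b ιB C38).IsAnalyticExt j) (fun j => holderTYC (f j).toKIdx) :=
  thmsT_holderTYC_of_b9LeafX_carriersYU (extraYPb (Matrix (Fin N) (Fin N) ℂ) (specialUnitaryUnits (Fin N))) (specialUnitaryUnits (Fin N))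
    f b ιB C38 ops h

end Record

/-! ## §7 (edition v1.1) ANY LIFT DIRECTION `E : 𝔸`, and the PLAIN-TAXI instance `holderTYP` reading dag-n06-l's transporter tables `taxiS ∕ taxiB` -/

section AnyDirection

variable {i}

/-- the UNIT DIRECTION of `E`: `‖E‖⁻¹·E ∈` the closed unit ball (`= 0` at `E = 0`). [cite: Balaban1985BackgroundPropagators, (3.39) p.397, bookkeeping] -/
def unitDirY (E : 𝔸) : BallY 𝔸 :=
  ⟨(((‖E‖⁻¹ : ℝ)) : ℂ) • E, mem_closedBall_zero_iff.2 (by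
    rw [norm_smul, Complex.norm_real, Real.norm_eq_abs, abs_of_nonneg (inv_nonneg.2 (norm_nonneg E))]
    rcases eq_or_ne ‖E‖ 0 with h | h
    · rw [h, mul_zero]; exact zero_le_one
    · rw [inv_mul_cancel₀ h])⟩

/-- `unitDirY` unfolded. [cite: Balaban1985BackgroundPropagators, (3.39) p.397, bookkeeping] -/
theorem unitDirY_coe (E : 𝔸) : (unitDirY E : 𝔸) = (((‖E‖⁻¹ : ℝ)) : ℂ) • E := rfl

/-- `λ ⊗ E = ‖E‖·(λ ⊗ ‖E‖⁻¹E)` pointwise, for `E ≠ 0`. [cite: Balaban1985BackgroundPropagators, (3.39) p.397, bookkeeping] -/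
theorem liftY_eq_norm_smul_unitDirY {X : Type} (f : X → ℝ) {E : 𝔸} (hE : ‖E‖ ≠ 0) (z : X) :
    liftY f E z = (((‖E‖ : ℝ)) : ℂ) • liftY f (unitDirY E : 𝔸) z := by
  simp only [liftY, unitDirY_coe]
  rw [smul_comm (((f z : ℝ)) : ℂ) (((‖E‖⁻¹ : ℝ)) : ℂ) E, smul_smul, ← Complex.ofReal_mul, mul_inv_cancel₀ hE, Complex.ofReal_one, one_smul]

/-- ★★ **ANY DIRECTION, SITES**: the transported Hölder quotient of `f ⊗ E` is at most `‖E‖` times the ball functional — for EVERY `E : 𝔸`, not only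
`‖E‖ ≤ 1` (homogeneity in the direction; the letter a coordinate reading of (3.40) in a frame `b : κ → 𝔸` consumes at `E = b k`).
[cite: Balaban1985BackgroundPropagators, (3.40) p.397, bookkeeping] -/
theorem hqS_liftY_le_norm_mul_holderSiteTY (parS : SiteParY 𝔸 i) (U : CfgY 𝔸 i) (ε : ℝ) (f : SiteY i → ℝ) (E : 𝔸) :
    hqS i (parS U) ε (liftY f E) ≤ ‖E‖ * holderSiteTY i parS U ε f := by
  have h0 : 0 ≤ ‖E‖ * holderSiteTY i parS U ε f := mul_nonneg (norm_nonneg E) (holderSiteTY_nonneg i parS U ε f)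
  refine hqS_le_of_forall i _ ε _ h0 (fun z z' hne => ?_)
  rcases eq_or_ne ‖E‖ 0 with hE | hE
  · have hE0 : E = 0 := norm_eq_zero.1 hE
    subst hE0
    have hl : ∀ w, liftY f (0 : 𝔸) w = 0 := fun w => smul_zero _
    rw [hl, hl, R_zero, sub_zero, norm_zero, zero_div, zero_mul]
  · rw [liftY_eq_norm_smul_unitDirY f hE z, liftY_eq_norm_smul_unitDirY f hE z', R_smul, ← smul_sub, norm_smul, Complex.norm_real,
      Real.norm_eq_abs, abs_of_nonneg (norm_nonneg E), mul_div_assoc]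
    exact mul_le_mul_of_nonneg_left ((pair_le_hqS i _ ε _ hne).trans (hqS_liftY_le_holderSiteTY i parS U ε f (unitDirY E))) (norm_nonneg E)

omit [CompleteSpace 𝔸] in
/-- the bond pair term of `J ⊗ 0` vanishes. [cite: Balaban1985BackgroundPropagators, (3.40) p.397, bookkeeping] -/
theorem bondTerm_liftY_zero (par : Site (PV d ℓ i.m i.K hd hL) 0 → Site (PV d ℓ i.m i.K hd hL) 0 → 𝔸ˣ) (ε : ℝ) (J : FBondY i → ℝ)
    (x x' : FBondY i) : tpar i x x' ^ (-ε) * ‖liftY J (0 : 𝔸) x - R (par x.src x'.src) (liftY J (0 : 𝔸) x')‖ = 0 := by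
  have hl : ∀ w, liftY J (0 : 𝔸) w = 0 := fun w => smul_zero _
  rw [hl, hl, R_zero, sub_zero, norm_zero, mul_zero]

/-- ★★ **ANY DIRECTION, BONDS**: `hqAB (J ⊗ E) ≤ ‖E‖ · holderBondTY J` for EVERY `E : 𝔸`. [cite: Balaban1985BackgroundPropagators, (3.40) p.397; Balaban1984PropagatorsII, (2.137) p.247, bookkeeping] -/
theorem hqAB_liftY_le_norm_mul_holderBondTY (parB : BondParY 𝔸 i) (U : CfgY 𝔸 i) (ε : ℝ) (J : FBondY i → ℝ) (E : 𝔸) :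
    hqAB i (parB U) ε (liftY J E) ≤ ‖E‖ * holderBondTY i parB U ε J := by
  have h0 : 0 ≤ ‖E‖ * holderBondTY i parB U ε J := mul_nonneg (norm_nonneg E) (holderBondTY_nonneg i parB U ε J)
  refine hqAB_le_of_forall_adm i _ ε _ h0 (fun x x' hadm => ?_)
  rcases eq_or_ne ‖E‖ 0 with hE | hE
  · have hE0 : E = 0 := norm_eq_zero.1 hE
    subst hE0
    rw [bondTerm_liftY_zero]; exact h0
  · rw [liftY_eq_norm_smul_unitDirY J hE x, liftY_eq_norm_smul_unitDirY J hE x', R_smul, ← smul_sub, norm_smul, Complex.norm_real,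
      Real.norm_eq_abs, abs_of_nonneg (norm_nonneg E), mul_left_comm]
    exact mul_le_mul_of_nonneg_left ((pair_le_hqAB i _ ε _ hadm).trans (hqAB_liftY_le_holderBondTY i parB U ε J (unitDirY E))) (norm_nonneg E)

/-- ★★ any direction, at the `KLoc` letter (sites). [cite: Balaban1985BackgroundPropagators, (3.40) p.397, bookkeeping] -/
theorem hqS_liftY_le_norm_mul_holderTY (parS : SiteParY 𝔸 i) (parB : BondParY 𝔸 i) (U : CfgY 𝔸 i) (ε : ℝ) (f : SiteY i → ℝ) (E : 𝔸) :
    hqS i (parS U) ε (liftY f E) ≤ ‖E‖ * holderTY i parS parB U ε (Sum.inl f) := by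
  rw [holderTY_inl]; exact hqS_liftY_le_norm_mul_holderSiteTY parS U ε f E

/-- ★★ any direction, at the `KLoc` letter (bonds). [cite: Balaban1985BackgroundPropagators, (3.40) p.397, bookkeeping] -/
theorem hqAB_liftY_le_norm_mul_holderTY (parS : SiteParY 𝔸 i) (parB : BondParY 𝔸 i) (U : CfgY 𝔸 i) (ε : ℝ) (J : FBondY i → ℝ) (E : 𝔸) :
    hqAB i (parB U) ε (liftY J E) ≤ ‖E‖ * holderTY i parS parB U ε (Sum.inr J) := by
  rw [holderTY_inr]; exact hqAB_liftY_le_norm_mul_holderBondTY parB U ε J E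

end AnyDirection

section PlainTaxi

/-- ★★ **THE PLAIN-TAXI INSTANCE `holderTYP`** := `holderTY` at the UNSYMMETRISED site table `parSY` (`U(Γ_{z,z′})` along FILE 2's taxicab contour from
`z` to `z′` for every ordered pair) and the bond table `parBY` — DEFINITIONALLY dag-n06-l's tables of the transported classes: `B9GradViaDivLettersTransported.taxiS
i bg cfg U₁ = parSY i (cfg U₁)` and `taxiB i bg cfg U₁ x x′ = parBY i (cfg U₁) x.src x′.src` (both sides are literally `parTaxiV (cfg U₁) …`; `rfl` at the
consumer, which has both files in scope).  It differs from the instance of record `holderTYR` (symmetrised site table `parSymY`, R7: `U(Γ_{w,z}) =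
U(Γ_{z,w})⁻¹`) only on lexicographically DECREASING site pairs, by the change of shortest contour; the domination of `geo9K.holder`, the `U = 1` face and
the v4 ⇒ T transfer hold for it verbatim (they hold for every table pair). [cite: Balaban1985BackgroundPropagators, (3.40) p.397 («Γ_{x,x′} is a shortest contour connecting points x and x′»)] -/
def holderTYP : CfgY 𝔸 i → ℝ → KLoc i → ℝ := holderTY i (parSY i) (parBY i)

/-- `holderTYP` unfolded. [cite: Balaban1985BackgroundPropagators, (3.40) p.397, bookkeeping] -/
theorem holderTYP_eq : holderTYP (𝔸 := 𝔸) i = holderTY i (parSY i) (parBY i) := rfl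

/-- at `U = 1` the plain site table is trivial. [cite: Balaban1985BackgroundPropagators, p.407 l.32–34 (U = 1 is [4]), bookkeeping] -/
theorem parSY_one_eq : parSY (𝔸 := 𝔸) i (fun _ _ => 1) = fun _ _ => 1 :=
  funext fun z => funext fun w => parSY_one i z w

variable [NormOneClass 𝔸]

/-- ★★★ **DOMINATION** for the plain-taxi instance: `(geo9K i).holder ε λ ≤ holderTYP i U ε λ` at every `U`. [cite: Balaban1985BackgroundPropagators, (3.40) p.397; Balaban1984PropagatorsII, (2.67) p.234, (2.137) p.247] -/
theorem geo9K_holder_le_holderTYP (U : CfgY 𝔸 i) (ε : ℝ) (lam : KLoc i) : (geo9K i).holder ε lam ≤ holderTYP i U ε lam :=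
  geo9K_holder_le_holderTY i (parSY i) (parBY i) U ε lam

/-- ★★ **THE `U = 1` FACE** of the plain-taxi instance IS r03's data norm. [cite: Balaban1985BackgroundPropagators, p.407 l.32–34 (U = 1 is [4]); Balaban1984PropagatorsII, (2.67) p.234, (2.137) p.247] -/
theorem holderTYP_one (ε : ℝ) (lam : KLoc i) : holderTYP (𝔸 := 𝔸) i (fun _ _ => 1) ε lam = (geo9K i).holder ε lam :=
  holderTY_eq_geo9K_holder_of_trivial i (parSY i) (parBY i) (fun _ _ => 1) (parSY_one_eq i) (parBY_one_eq i) ε lam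

end PlainTaxi

section LeafAnyTables

open DagBinding (B9Leaf B9LeafX)
open B9SectBCodedClassR (RegExtraY extraYPb)
open B9SectBGpReadingsY (baseY)
open B9PinCarriersKLevelV1 (OperatorLayerY)
open B9PinGeometryKLevelV1 (c35Y)
open B9Eq360DeltaPrimeAY (AfldY)
open B9SectBCodedCarrier (CCfg)

variable {i}

/-- ★★ the plain-taxi data norm over the CODED carrier: the norm of the BASE configuration (as `holderTYC`, R13-U1).
[cite: Balaban1985BackgroundPropagators, Thm 3.4 p.400, p.403 l.1–9, (3.40) p.397] -/
def holderTYPC (i : KIdx d ℓ hd hL b₀ b₁) : CCfg (CfgY 𝔸 i) (AfldY 𝔸 i) → ℝ → KLoc i → ℝ := fun W => holderTYP i (baseY i W)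

/-- at a base configuration. [cite: Balaban1985BackgroundPropagators, (3.40) p.397, bookkeeping] -/
@[simp] theorem holderTYPC_base (U : CfgY 𝔸 i) : holderTYPC i (.base U) = holderTYP i U := rfl

/-- at a product `U′U`: the norm OF THE BASE `U`. [cite: Balaban1985BackgroundPropagators, Thm 3.4 p.400, p.403 l.1–9, bookkeeping] -/
@[simp] theorem holderTYPC_prod (U : CfgY 𝔸 i) (a : AfldY 𝔸 i) : holderTYPC i (.prod U a) = holderTYP i U := rfl

variable [NormOneClass 𝔸] (P : RegExtraY d ℓ hd hL b₀ b₁ Mstar 𝔸) (G : Subgroup 𝔸ˣ) {J : Type} (f : J → MemberY d ℓ hd hL b₀ b₁ Mstar)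
  {ι : Type} [Fintype ι] (b : Module.Basis ι ℝ 𝔸) (ιB : ∀ j : J, BlkY (f j).toKIdx → IBondY (f j).toKIdx)
  (C38 : ∀ j : J, ℝ → CfgY 𝔸 (f j).toKIdx → AfldY 𝔸 (f j).toKIdx → Prop) (ops : ∀ x : MemberY d ℓ hd hL b₀ b₁ Mstar, OperatorLayerY d ℓ hd hL b₀ b₁ Mstar 𝔸 G x)

/-- ★★★ **THE EXTENDED LEAF OVER `carriersYU` YIELDS THEOREMS 3.1 ∕ 3.3 ∕ 3.4 IN T-FORM FOR EVERY PAIR OF TRANSPORTER TABLES** `parS j ∕ parB j`, with the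
data norm `W ↦ holderTY (parS j) (parB j) (base W)` (§6 is the instance `parSymY ∕ parBY`). [cite: Balaban1985BackgroundPropagators, Thms 3.1–3.4 pp.397–400, (3.40) p.397, (3.44)–(3.45) p.398] -/
theorem thmsT_holderTYtab_of_b9LeafX_carriersYU (parS : ∀ j, SiteParY 𝔸 (f j).toKIdx) (parB : ∀ j, BondParY 𝔸 (f j).toKIdx)
    (h : B9LeafX (carriersYU P G f b ιB C38 ops)) :
    Thm31PrintedT c35Y (fun j => geo9Y (f j)) (fun j => (codingYU P G f ιB C38 j).bg) (fun j => (carriersYU P G f b ιB C38 ops).Gp j)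
        (fun j W => holderTY (f j).toKIdx (parS j) (parB j) (baseY (f j).toKIdx W)) ∧
      Thm33PrintedT c35Y (fun j => geo9Y (f j)) (fun j => (codingYU P G f ιB C38 j).bg) (fun j => (carriersYU P G f b ιB C38 ops).Gp j)
        (fun j => (carriersYU P G f b ιB C38 ops).GA j) (fun j W => holderTY (f j).toKIdx (parS j) (parB j) (baseY (f j).toKIdx W)) ∧
      Thm34PrintedT c35Y (fun j => geo9Y (f j)) (fun j => (codingYU P G f ιB C38 j).bg) (fun j => (carriersYU P G f b ιB C38 ops).Gp j)
        (fun j => (carriersYU P G f b ιB C38 ops).GA j) (fun j => (carriersYU P G f b ιB C38 ops).IsAnalyticExt j)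
        (fun j W => holderTY (f j).toKIdx (parS j) (parB j) (baseY (f j).toKIdx W)) :=
  ⟨thm31PrintedT_holderTY_of_printed (bg := fun j => (codingYU P G f ιB C38 j).bg) (Gp := fun j => (carriersYU P G f b ιB C38 ops).Gp j)
      (fun j => (f j).toKIdx) parS parB (fun j W => baseY (f j).toKIdx W) h.numbered.t31,
    thm33PrintedT_holderTY_of_printed (bg := fun j => (codingYU P G f ιB C38 j).bg) (Gp := fun j => (carriersYU P G f b ιB C38 ops).Gp j)
      (GA := fun j => (carriersYU P G f b ιB C38 ops).GA j) (fun j => (f j).toKIdx) parS parB (fun j W => baseY (f j).toKIdx W) h.numbered.t33,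
    thm34PrintedT_holderTY_of_printed (bg := fun j => (codingYU P G f ιB C38 j).bg) (Gp := fun j => (carriersYU P G f b ιB C38 ops).Gp j)
      (GA := fun j => (carriersYU P G f b ιB C38 ops).GA j) (IsAnalyticExt := fun j => (carriersYU P G f b ιB C38 ops).IsAnalyticExt j)
      (fun j => (f j).toKIdx) parS parB (fun j W => baseY (f j).toKIdx W) h.numbered.t34⟩

/-- ★★★ the plain-taxi instance over `carriersYU`. [cite: Balaban1985BackgroundPropagators, Thms 3.1–3.4 pp.397–400, (3.40) p.397] -/
theorem thmsT_holderTYPC_of_b9LeafX_carriersYU (h : B9LeafX (carriersYU P G f b ιB C38 ops)) :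
    Thm31PrintedT c35Y (fun j => geo9Y (f j)) (fun j => (codingYU P G f ιB C38 j).bg) (fun j => (carriersYU P G f b ιB C38 ops).Gp j)
        (fun j => holderTYPC (f j).toKIdx) ∧
      Thm33PrintedT c35Y (fun j => geo9Y (f j)) (fun j => (codingYU P G f ιB C38 j).bg) (fun j => (carriersYU P G f b ιB C38 ops).Gp j)
        (fun j => (carriersYU P G f b ιB C38 ops).GA j) (fun j => holderTYPC (f j).toKIdx) ∧
      Thm34PrintedT c35Y (fun j => geo9Y (f j)) (fun j => (codingYU P G f ιB C38 j).bg) (fun j => (carriersYU P G f b ιB C38 ops).Gp j)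
        (fun j => (carriersYU P G f b ιB C38 ops).GA j) (fun j => (carriersYU P G f b ιB C38 ops).IsAnalyticExt j)
        (fun j => holderTYPC (f j).toKIdx) :=
  thmsT_holderTYtab_of_b9LeafX_carriersYU P G f b ιB C38 ops (fun j => parSY (f j).toKIdx) (fun j => parBY (f j).toKIdx) h

end LeafAnyTables

section RecordAnyTables

open DagBinding (B9LeafX)
open B9SectBCodedClassR (extraYPb)
open B9SectBGpReadingsY (baseY)
open B9PinGeometryKLevelV1 (c35Y)
open B9Eq360DeltaPrimeAY (AfldY)
open B7Prop2SpecialUnitary (specialUnitaryUnits)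
open scoped Matrix.Norms.L2Operator

variable {N : ℕ} [NormOneClass (Matrix (Fin N) (Fin N) ℂ)] (θ : Stage3Params) (Mstar : ℕ) (ops : OpsY N θ Mstar) {J : Type}
  (f : J → MemberY θ.d₆ θ.ℓ₆ θ.hd' θ.hL' θ.b₀ θ.b₁ Mstar) {ι : Type} [Fintype ι] (b : Module.Basis ι ℝ (Matrix (Fin N) (Fin N) ℂ))
  (ιB : ∀ j : J, BlkY (f j).toKIdx → IBondY (f j).toKIdx)
  (C38 : ∀ j : J, ℝ → CfgY (Matrix (Fin N) (Fin N) ℂ) (f j).toKIdx → AfldY (Matrix (Fin N) (Fin N) ℂ) (f j).toKIdx → Prop)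

/-- ★★★ **AT THE RECORD, EVERY PAIR OF TRANSPORTER TABLES**: the extended leaf over the N06 certificate's conclusion object yields Theorems 3.1 ∕ 3.3 ∕ 3.4
in T-form with the data norm `W ↦ holderTY (parS j) (parB j) (base W)`. [cite: Balaban1985BackgroundPropagators, Thms 3.1–3.4 pp.397–400, (3.40) p.397, (3.44)–(3.45) p.398] -/
theorem thmsT_holderTYtab_of_b9LeafX_record (parS : ∀ j, SiteParY (Matrix (Fin N) (Fin N) ℂ) (f j).toKIdx)
    (parB : ∀ j, BondParY (Matrix (Fin N) (Fin N) ℂ) (f j).toKIdx) (h : B9LeafX (Y9OfRecordUPb N θ Mstar ops f b ιB C38)) :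
    Thm31PrintedT c35Y (fun j => geo9Y (f j))
        (fun j => (codingYU (extraYPb (Matrix (Fin N) (Fin N) ℂ) (specialUnitaryUnits (Fin N))) (specialUnitaryUnits (Fin N)) f ιB C38 j).bg)
        (fun j => (Y9OfRecordUPb N θ Mstar ops f b ιB C38).Gp j) (fun j W => holderTY (f j).toKIdx (parS j) (parB j) (baseY (f j).toKIdx W)) ∧
      Thm33PrintedT c35Y (fun j => geo9Y (f j))
        (fun j => (codingYU (extraYPb (Matrix (Fin N) (Fin N) ℂ) (specialUnitaryUnits (Fin N))) (specialUnitaryUnits (Fin N)) f ιB C38 j).bg)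
        (fun j => (Y9OfRecordUPb N θ Mstar ops f b ιB C38).Gp j) (fun j => (Y9OfRecordUPb N θ Mstar ops f b ιB C38).GA j)
        (fun j W => holderTY (f j).toKIdx (parS j) (parB j) (baseY (f j).toKIdx W)) ∧
      Thm34PrintedT c35Y (fun j => geo9Y (f j))
        (fun j => (codingYU (extraYPb (Matrix (Fin N) (Fin N) ℂ) (specialUnitaryUnits (Fin N))) (specialUnitaryUnits (Fin N)) f ιB C38 j).bg)
        (fun j => (Y9OfRecordUPb N θ Mstar ops f b ιB C38).Gp j) (fun j => (Y9OfRecordUPb N θ Mstar ops f b ιB C38).GA j)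
        (fun j => (Y9OfRecordUPb N θ Mstar ops f b ιB C38).IsAnalyticExt j)
        (fun j W => holderTY (f j).toKIdx (parS j) (parB j) (baseY (f j).toKIdx W)) :=
  thmsT_holderTYtab_of_b9LeafX_carriersYU (extraYPb (Matrix (Fin N) (Fin N) ℂ) (specialUnitaryUnits (Fin N))) (specialUnitaryUnits (Fin N))
    f b ιB C38 ops parS parB h

/-- ★★★ **AT THE RECORD, THE PLAIN-TAXI INSTANCE** `holderTYPC` (the slot instance that reads dag-n06-l's `taxiS ∕ taxiB` tables definitionally).
[cite: Balaban1985BackgroundPropagators, Thms 3.1–3.4 pp.397–400, (3.40) p.397, (3.44)–(3.45) p.398] -/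
theorem thmsT_holderTYPC_of_b9LeafX_record (h : B9LeafX (Y9OfRecordUPb N θ Mstar ops f b ιB C38)) :
    Thm31PrintedT c35Y (fun j => geo9Y (f j))
        (fun j => (codingYU (extraYPb (Matrix (Fin N) (Fin N) ℂ) (specialUnitaryUnits (Fin N))) (specialUnitaryUnits (Fin N)) f ιB C38 j).bg)
        (fun j => (Y9OfRecordUPb N θ Mstar ops f b ιB C38).Gp j) (fun j => holderTYPC (f j).toKIdx) ∧
      Thm33PrintedT c35Y (fun j => geo9Y (f j))
        (fun j => (codingYU (extraYPb (Matrix (Fin N) (Fin N) ℂ) (specialUnitaryUnits (Fin N))) (specialUnitaryUnits (Fin N)) f ιB C38 j).bg)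
        (fun j => (Y9OfRecordUPb N θ Mstar ops f b ιB C38).Gp j) (fun j => (Y9OfRecordUPb N θ Mstar ops f b ιB C38).GA j)
        (fun j => holderTYPC (f j).toKIdx) ∧
      Thm34PrintedT c35Y (fun j => geo9Y (f j))
        (fun j => (codingYU (extraYPb (Matrix (Fin N) (Fin N) ℂ) (specialUnitaryUnits (Fin N))) (specialUnitaryUnits (Fin N)) f ιB C38 j).bg)
        (fun j => (Y9OfRecordUPb N θ Mstar ops f b ιB C38).Gp j) (fun j => (Y9OfRecordUPb N θ Mstar ops f b ιB C38).GA j)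
        (fun j => (Y9OfRecordUPb N θ Mstar ops f b ιB C38).IsAnalyticExt j) (fun j => holderTYPC (f j).toKIdx) :=
  thmsT_holderTYtab_of_b9LeafX_record θ Mstar ops f b ιB C38 (fun j => parSY (f j).toKIdx) (fun j => parBY (f j).toKIdx) h

end RecordAnyTables

end Literature.MathematicalPhysics.QuantumFieldTheory.Balaban1983to89.Node00.OpsYHolderT
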